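import Literature.Analysis.SpecialFunctions.ZhouTripleEllipticIntegralProofs
import Literature.Analysis.FunctionSpaces.BesselMomentsKernelAnalytic
import HarnessLib

/-!
# Zhou 2013, Proposition 5.1 — proofs, part II: `∫₀¹K′³ = 3∫₀¹K²K′` by a Wick rotation

Second companion file of `ZhouTripleEllipticIntegral.lean` (fact `Zhou2013_prop_5_1`). Layer (a) of
the printed proof of Prop. 5.1 (Y. Zhou, arXiv:1301.1735, p. 23) is the identity
`∫₀¹ K(√(1−k²))³ dk = 3∫₀¹ K(k)²K(√(1−k²)) dk`, obtained in print by "Tricomi pairing" (the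
Parseval identity of the finite Hilbert transform on `L^p(−1,1)` applied to the principal values
(P_minus_half_T) and (RamanujanT)). The finite Hilbert transform is not in Mathlib; we prove the
same identity by the complex-variable mechanism behind those principal values (the road Zhou himself
takes in later work, "Wick rotations", arXiv:1706.08308): in parameter form `𝒦(x) = ellipticK x`,
the function `A(m) = 𝒦(m) + i𝒦(1−m)` continues analytically to the lower half `m`-plane, is real
on `(1,∞)` and purely imaginary on `(−∞,0)` (inverse- and imaginary-modulus transformations of `K`),
so `H = A³(1−m)^{−1/2}` is purely imaginary on both rays, `O(|m|^{−5/4})` at infinity, and Cauchy's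
theorem for rectangles gives `Re ∫₀¹ (𝒦 + i𝒦′)³(1−x)^{−1/2} dx = 0`, i.e.
`∫₀¹ (𝒦³ − 3𝒦𝒦′²)(1−x)^{−1/2} dx = 0`, which is layer (a) after `x = 1 − k²`.

Contents (everything proved; the helper definitions `kcDomain`, `kcKernel`, `kcKernelDeriv`, `Kc`,
`wickA`, `wickH`, `wickH₀`, `wickDecayConst`, `wickMidConst`, `wickDom` are ordinary definitions,
not named facts):

* real-variable transformations of `ellipticK`: the imaginary-modulus transformation
  `K(−μ) = (1+μ)^{−1/2}K(μ/(1+μ))` (`ellipticK_neg`) and the two halves of the inverse-modulus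
  transformation, `∫₀^{1/√r} dt/√((1−t²)(1−rt²)) = r^{−1/2}K(1/r)`,
  `∫_{1/√r}^1 dt/√((1−t²)(rt²−1)) = r^{−1/2}K(1−1/r)` (`r > 1`), with integrability;
* `Kc m = ∫₀¹ (1−t²)^{−1/2}(1−mt²)^{−1/2} dt` (principal branch): holomorphic on `ℂ ∖ [1,∞)`
  (differentiation under the integral sign), `= ellipticK m` for real `m < 1`, boundary value from
  below on the cut `Kc x = x^{−1/2}(K(1/x) − iK(1−1/x))` (`x > 1`, Zhou's eq. (inv_mod)), norm bounds
  and the vertical limits `Kc(x − εi) → Kc x` (`x ≠ 1`);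
* `H = A³(1−m)^{−1/2}`, `A = Kc m + i·conj(Kc(1 − conj m))`: holomorphic on the lower half-plane,
  `O(‖m‖^{−13/8})`, so by the Cauchy–Goursat theorem for rectangles `∫_ℝ H(x − εi) dx` is
  independent of `ε > 0` and, letting the line recede, equal to `0`
  (`integral_wickH_horizontal_eq_zero`);
* the limit `ε → 0⁺` (dominated convergence with an explicit envelope `wickDom`) and the real parts
  of the boundary values (`Re H₀ = 0` on the two rays by the two transformations above) give
  `∫₀¹ (1−x)^{−1/2}(K(x)³ − 3K(x)K(1−x)²) dx = 0` (`integral_rpow_mul_ellipticK_cube_sub_eq_zero`),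
  hence, after `x = 1 − k²`, **layer (a)** `∫₀¹K(√(1−k²))³ = 3∫₀¹K²K(√(1−k²))`
  (`integral_completeEllipticK_compl_pow_three_eq_three_mul`) and, with layer (b) from
  `ZhouTripleEllipticIntegralProofs.lean`, `∫₀¹K(√(1−k²))³ dk = 6∫₀¹K(k)²K(√(1−k²))k dk`;
* `Zhou2013_prop_5_1_of_T_half_half`: Prop. 5.1 follows from the printed value
  `6∫₀¹K²K(√(1−k²))k dk = Γ(¼)⁸/(128π²)` (Zhou's eq. (T_half_half) = Cor. 3.2, from Prop. 3.1 by
  complex-degree Legendre asymptotics), which is the one remaining, transcendental, input.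

## References

* [Zhou2013] Y. Zhou, Ramanujan J. 34 (2014) 373–428, Prop. 5.1, Cor. 4.2 (P_minus_half_T),
  eq. (inv_mod) (arXiv:1301.1735 pp. 17–18, 23).
-/

noncomputable section

open Real _root_.MeasureTheory _root_.Set _root_.Filter
open scoped _root_.Topology _root_.Interval

namespace Literature.Analysis.SpecialFunctions

open Literature.Probability.RandomPlanarGeometry

/-! ### The imaginary-modulus transformation (real form) -/

/-- **Imaginary-modulus transformation** in parameter form: for `μ ≥ 0`,
`K(−μ) = (1+μ)^{−1/2} K(μ/(1+μ))`, i.e. `∫₀¹ dt/√((1−t²)(1+μt²)) = (1/√(1+μ))∫₀¹ ds/√((1−s²)(1−(μ/(1+μ))s²))`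
(substitution `t = √(1−s²)`). [cite: Zhou2013, §4.1 proof of Lemma 4.1 ("imaginary modulus transformation")] -/
theorem ellipticK_neg {μ : ℝ} (hμ : 0 ≤ μ) :
    ellipticK (-μ) = 1 / Real.sqrt (1 + μ) * ellipticK (μ / (1 + μ)) := by
  have h1μ : 0 < 1 + μ := by linarith
  have hs1 : 0 < Real.sqrt (1 + μ) := Real.sqrt_pos.mpr h1μ
  rw [ellipticK_eq, ellipticK_eq, intervalIntegral.integral_of_le zero_le_one,
    intervalIntegral.integral_of_le zero_le_one, integral_Ioc_eq_integral_Ioo,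
    integral_Ioc_eq_integral_Ioo, integral_Ioo_comp_sqrt_one_sub_sq (ellIntegrand (-μ)),
    ← integral_const_mul]
  refine setIntegral_congr_fun measurableSet_Ioo (fun s hs => ?_)
  have hs2 : 0 < 1 - s ^ 2 := by nlinarith [hs.1, hs.2]
  have hq : 0 < Real.sqrt (1 - s ^ 2) := Real.sqrt_pos.mpr hs2
  have hqq : Real.sqrt (1 - s ^ 2) ^ 2 = 1 - s ^ 2 := Real.sq_sqrt hs2.le
  have hν : 0 < 1 - μ / (1 + μ) * s ^ 2 := by
    have : μ / (1 + μ) * s ^ 2 < 1 := by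
      have h1 : μ / (1 + μ) < 1 := (div_lt_one h1μ).mpr (by linarith)
      have h2 : 0 ≤ μ / (1 + μ) := div_nonneg hμ h1μ.le
      calc μ / (1 + μ) * s ^ 2 ≤ μ / (1 + μ) * 1 := by
            apply mul_le_mul_of_nonneg_left _ h2; nlinarith [hs.1, hs.2]
        _ < 1 := by linarith
    linarith
  unfold ellIntegrand
  rw [hqq]
  have e1 : (1 - (1 - s ^ 2)) * (1 - -μ * (1 - s ^ 2)) = s ^ 2 * ((1 + μ) * (1 - μ / (1 + μ) * s ^ 2)) := by
    field_simp
    ring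
  rw [e1, Real.sqrt_mul (sq_nonneg s), Real.sqrt_sq hs.1.le, Real.sqrt_mul h1μ.le,
    Real.sqrt_mul hs2.le]
  have hs0 : s ≠ 0 := hs.1.ne'
  field_simp

/-! ### The two halves of the inverse-modulus transformation (real form) -/

/-- First half of the inverse-modulus transformation: for `r > 1`,
`∫_{(0,1/√r)} dt/√((1−t²)(1−rt²)) = (1/√r)·K(1/r)` (substitution `t = s/√r`), together with the
integrability of the integrand there. [cite: Zhou2013, eq. (inv_mod) (arXiv p. 18)] -/
theorem integral_Ioo_inv_sqrt_lt {r : ℝ} (hr : 1 < r) :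
    IntegrableOn (fun t : ℝ => 1 / Real.sqrt ((1 - t ^ 2) * (1 - r * t ^ 2))) (Ioo 0 (1 / Real.sqrt r)) ∧
    ∫ t in Ioo (0 : ℝ) (1 / Real.sqrt r), 1 / Real.sqrt ((1 - t ^ 2) * (1 - r * t ^ 2)) =
      1 / Real.sqrt r * ellipticK (1 / r) := by
  have hr0 : 0 < r := by linarith
  have hq : 0 < Real.sqrt r := Real.sqrt_pos.mpr hr0
  have hqq : Real.sqrt r ^ 2 = r := Real.sq_sqrt hr0.le
  set φ : ℝ → ℝ := fun s => s / Real.sqrt r with hφ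
  have himage : φ '' Ioo (0 : ℝ) 1 = Ioo 0 (1 / Real.sqrt r) := by
    ext t
    constructor
    · rintro ⟨s, hs, rfl⟩
      exact ⟨div_pos hs.1 hq, by simp only [hφ]; exact div_lt_div_of_pos_right hs.2 hq⟩
    · intro ht
      refine ⟨t * Real.sqrt r, ⟨mul_pos ht.1 hq, ?_⟩, by simp only [hφ]; field_simp⟩
      have := ht.2
      rw [lt_div_iff₀ hq] at this
      exact this
  have hderiv : ∀ s ∈ Ioo (0 : ℝ) 1, HasDerivWithinAt φ (1 / Real.sqrt r) (Ioo 0 1) s := by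
    intro s _
    have := (hasDerivAt_id s).div_const (Real.sqrt r)
    simpa [hφ] using this.hasDerivWithinAt
  have hinj : InjOn φ (Ioo 0 1) := fun a _ b _ hab => by
    simp only [hφ] at hab
    field_simp at hab
    exact hab
  -- the pulled-back integrand is `(1/√r) · ellIntegrand (1/r)`
  have hpt : ∀ s ∈ Ioo (0 : ℝ) 1, |1 / Real.sqrt r| • (1 / Real.sqrt ((1 - φ s ^ 2) * (1 - r * φ s ^ 2))) =
      1 / Real.sqrt r * ellIntegrand (1 / r) s := by
    intro s hs
    rw [abs_of_pos (by positivity), smul_eq_mul]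
    congr 1
    simp only [hφ, ellIntegrand]
    rw [div_pow, hqq]
    congr 1
    congr 1
    field_simp
  have hint : IntegrableOn (fun s => 1 / Real.sqrt r * ellIntegrand (1 / r) s) (Ioo 0 1) := by
    have h := intervalIntegrable_ellIntegrand_of_lt_one (u := 1 / r) ((div_lt_one hr0).mpr hr)
    rw [intervalIntegrable_iff_integrableOn_Ioo_of_le zero_le_one] at h
    exact h.const_mul _
  constructor
  · rw [← himage, integrableOn_image_iff_integrableOn_abs_deriv_smul measurableSet_Ioo hderiv hinj]
    exact hint.congr_fun (fun s hs => (hpt s hs).symm) measurableSet_Ioo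
  · have key := integral_image_eq_integral_abs_deriv_smul measurableSet_Ioo hderiv hinj
      (fun t : ℝ => 1 / Real.sqrt ((1 - t ^ 2) * (1 - r * t ^ 2)))
    rw [himage] at key
    rw [key, ellipticK_eq, intervalIntegral.integral_of_le zero_le_one, integral_Ioc_eq_integral_Ioo,
      ← integral_const_mul]
    exact setIntegral_congr_fun measurableSet_Ioo hpt

/-- Pointwise identity behind the second half: for `r > 1`, `0 < s < 1` and
`ψ = √(1 − (1−1/r)s²)`, `((1−1/r)s/ψ)/√((1−ψ²)(rψ²−1)) = (1/√r)/√((1−s²)(1−(1−1/r)s²))`. [folklore] -/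
theorem inv_mod_subst {r s : ℝ} (hr : 1 < r) (hs : s ∈ Ioo (0 : ℝ) 1) :
    (1 - 1 / r) * s / Real.sqrt (1 - (1 - 1 / r) * s ^ 2) *
        (1 / Real.sqrt ((1 - Real.sqrt (1 - (1 - 1 / r) * s ^ 2) ^ 2) *
          (r * Real.sqrt (1 - (1 - 1 / r) * s ^ 2) ^ 2 - 1))) =
      1 / Real.sqrt r * (1 / Real.sqrt ((1 - s ^ 2) * (1 - (1 - 1 / r) * s ^ 2))) := by
  have hr0 : 0 < r := by linarith
  have hν0 : 0 < 1 - 1 / r := by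
    have : 1 / r < 1 := (div_lt_one hr0).mpr hr; linarith
  have hν1 : 1 - 1 / r < 1 := by
    have : 0 < 1 / r := by positivity
    linarith
  have hs2 : 0 < 1 - s ^ 2 := by nlinarith [hs.1, hs.2]
  have hw2 : 0 < 1 - (1 - 1 / r) * s ^ 2 := by nlinarith [hs.1, hs.2]
  set w := Real.sqrt (1 - (1 - 1 / r) * s ^ 2) with hw
  have hw0 : 0 < w := Real.sqrt_pos.mpr hw2
  have hww : w ^ 2 = 1 - (1 - 1 / r) * s ^ 2 := Real.sq_sqrt hw2.le
  have hq : 0 < Real.sqrt r := Real.sqrt_pos.mpr hr0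
  have hqq : Real.sqrt r ^ 2 = r := Real.sq_sqrt hr0.le
  have e1 : (1 - w ^ 2) * (r * w ^ 2 - 1) = ((1 - 1 / r) * s) ^ 2 * (r * (1 - s ^ 2)) := by
    rw [hww]; field_simp; ring
  have hpos : 0 < (1 - 1 / r) * s := mul_pos hν0 hs.1
  rw [e1, Real.sqrt_mul (sq_nonneg _), Real.sqrt_sq hpos.le, Real.sqrt_mul hr0.le,
    Real.sqrt_mul hs2.le, ← hw]
  have hr1 : r - 1 ≠ 0 := by
    have : (0 : ℝ) < r - 1 := by linarith
    exact this.ne'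
  have hs0 : s ≠ 0 := hs.1.ne'
  have hsq0 : Real.sqrt (1 - s ^ 2) ≠ 0 := (Real.sqrt_pos.mpr hs2).ne'
  field_simp

/-- Second half of the inverse-modulus transformation: for `r > 1`,
`∫_{(1/√r,1)} dt/√((1−t²)(rt²−1)) = (1/√r)·K(1−1/r)` (substitution `t = √(1−(1−1/r)s²)`),
together with the integrability of the integrand there. [cite: Zhou2013, eq. (inv_mod) (arXiv p. 18)] -/
theorem integral_Ioo_inv_sqrt_gt {r : ℝ} (hr : 1 < r) :
    IntegrableOn (fun t : ℝ => 1 / Real.sqrt ((1 - t ^ 2) * (r * t ^ 2 - 1))) (Ioo (1 / Real.sqrt r) 1) ∧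
    ∫ t in Ioo (1 / Real.sqrt r) (1 : ℝ), 1 / Real.sqrt ((1 - t ^ 2) * (r * t ^ 2 - 1)) =
      1 / Real.sqrt r * ellipticK (1 - 1 / r) := by
  have hr0 : 0 < r := by linarith
  have hq : 0 < Real.sqrt r := Real.sqrt_pos.mpr hr0
  have hqq : Real.sqrt r ^ 2 = r := Real.sq_sqrt hr0.le
  have hν0 : 0 < 1 - 1 / r := by
    have : 1 / r < 1 := (div_lt_one hr0).mpr hr; linarith
  have hν1 : 1 - 1 / r < 1 := by
    have : 0 < 1 / r := by positivity
    linarith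
  set ψ : ℝ → ℝ := fun s => Real.sqrt (1 - (1 - 1 / r) * s ^ 2) with hψ
  have hrad : ∀ s ∈ Ioo (0 : ℝ) 1, 0 < 1 - (1 - 1 / r) * s ^ 2 := fun s hs => by nlinarith [hs.1, hs.2]
  have himage : ψ '' Ioo (0 : ℝ) 1 = Ioo (1 / Real.sqrt r) 1 := by
    ext t
    constructor
    · rintro ⟨s, hs, rfl⟩
      refine ⟨?_, ?_⟩
      · simp only [hψ]
        rw [show 1 / Real.sqrt r = Real.sqrt (1 / r) by rw [Real.sqrt_div' 1 hr0.le, Real.sqrt_one] ]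
        apply Real.sqrt_lt_sqrt (by positivity)
        have : (1 - 1 / r) * s ^ 2 < (1 - 1 / r) * 1 :=
          mul_lt_mul_of_pos_left (by nlinarith [hs.1, hs.2]) hν0
        linarith
      · simp only [hψ]
        rw [Real.sqrt_lt' one_pos]
        nlinarith [mul_pos hν0 (pow_pos hs.1 2)]
    · intro ht
      have ht0 : 0 < t := lt_trans (by positivity) ht.1
      have ht2 : 1 / r < t ^ 2 := by
        have h1 := ht.1
        have : (1 / Real.sqrt r) ^ 2 < t ^ 2 := by
          exact pow_lt_pow_left₀ h1 (by positivity) two_ne_zero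
        rwa [div_pow, one_pow, hqq] at this
      set u := (1 - t ^ 2) / (1 - 1 / r) with hu
      have hu0 : 0 < u := div_pos (by nlinarith [ht.2]) hν0
      have hu1 : u < 1 := by rw [hu, div_lt_one hν0]; linarith
      refine ⟨Real.sqrt u, ⟨Real.sqrt_pos.mpr hu0, (Real.sqrt_lt' one_pos).mpr (by linarith)⟩, ?_⟩
      simp only [hψ]
      rw [Real.sq_sqrt hu0.le, hu, mul_div_cancel₀ _ hν0.ne', sub_sub_cancel, Real.sqrt_sq ht0.le]
  have hderiv : ∀ s ∈ Ioo (0 : ℝ) 1,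
      HasDerivWithinAt ψ (-((1 - 1 / r) * (2 * s)) / (2 * Real.sqrt (1 - (1 - 1 / r) * s ^ 2))) (Ioo 0 1) s := by
    intro s hs
    have h1 : HasDerivAt (fun s : ℝ => 1 - (1 - 1 / r) * s ^ 2) (-((1 - 1 / r) * (2 * s))) s := by
      simpa using ((hasDerivAt_pow 2 s).const_mul (1 - 1 / r)).const_sub 1
    exact (h1.sqrt (hrad s hs).ne').hasDerivWithinAt
  have hinj : InjOn ψ (Ioo 0 1) := by
    intro a ha b hb hab
    simp only [hψ] at hab
    have h2 : Real.sqrt (1 - (1 - 1 / r) * a ^ 2) ^ 2 = Real.sqrt (1 - (1 - 1 / r) * b ^ 2) ^ 2 := by rw [hab]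
    rw [Real.sq_sqrt (hrad a ha).le, Real.sq_sqrt (hrad b hb).le] at h2
    have h3 : a ^ 2 = b ^ 2 := by
      have := hν0.ne'
      have h4 : (1 - 1 / r) * a ^ 2 = (1 - 1 / r) * b ^ 2 := by linarith
      exact mul_left_cancel₀ this h4
    exact (pow_left_inj₀ ha.1.le hb.1.le two_ne_zero).mp h3
  have hpt : ∀ s ∈ Ioo (0 : ℝ) 1,
      |-((1 - 1 / r) * (2 * s)) / (2 * Real.sqrt (1 - (1 - 1 / r) * s ^ 2))| •
        (1 / Real.sqrt ((1 - ψ s ^ 2) * (r * ψ s ^ 2 - 1))) =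
      1 / Real.sqrt r * ellIntegrand (1 - 1 / r) s := by
    intro s hs
    have hw0 : 0 < Real.sqrt (1 - (1 - 1 / r) * s ^ 2) := Real.sqrt_pos.mpr (hrad s hs)
    rw [show -((1 - 1 / r) * (2 * s)) / (2 * Real.sqrt (1 - (1 - 1 / r) * s ^ 2)) =
        -((1 - 1 / r) * s / Real.sqrt (1 - (1 - 1 / r) * s ^ 2)) by field_simp,
      abs_neg, abs_of_pos (div_pos (mul_pos hν0 hs.1) hw0), smul_eq_mul]
    simp only [hψ, ellIntegrand]
    exact inv_mod_subst hr hs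
  have hint : IntegrableOn (fun s => 1 / Real.sqrt r * ellIntegrand (1 - 1 / r) s) (Ioo 0 1) := by
    have h := intervalIntegrable_ellIntegrand_of_lt_one (u := 1 - 1 / r) hν1
    rw [intervalIntegrable_iff_integrableOn_Ioo_of_le zero_le_one] at h
    exact h.const_mul _
  constructor
  · rw [← himage, integrableOn_image_iff_integrableOn_abs_deriv_smul measurableSet_Ioo hderiv hinj]
    exact hint.congr_fun (fun s hs => (hpt s hs).symm) measurableSet_Ioo
  · have key := integral_image_eq_integral_abs_deriv_smul measurableSet_Ioo hderiv hinj
      (fun t : ℝ => 1 / Real.sqrt ((1 - t ^ 2) * (r * t ^ 2 - 1)))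
    rw [himage] at key
    rw [key, ellipticK_eq, intervalIntegral.integral_of_le zero_le_one, integral_Ioc_eq_integral_Ioo,
      ← integral_const_mul]
    exact setIntegral_congr_fun measurableSet_Ioo hpt

/-- **The majorant integral for `r > 1`**: `t ↦ 1/√((1−t²)|1−rt²|)` is integrable on `(0,1)` and
`∫₀¹ dt/√((1−t²)|1−rt²|) = (1/√r)(K(1/r) + K(1−1/r))`. [cite: Zhou2013, eq. (inv_mod) (arXiv p. 18)] -/
theorem integral_Ioo_inv_sqrt_abs {r : ℝ} (hr : 1 < r) :
    IntegrableOn (fun t : ℝ => 1 / Real.sqrt ((1 - t ^ 2) * |1 - r * t ^ 2|)) (Ioo 0 1) ∧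
    ∫ t in Ioo (0 : ℝ) 1, 1 / Real.sqrt ((1 - t ^ 2) * |1 - r * t ^ 2|) =
      1 / Real.sqrt r * (ellipticK (1 / r) + ellipticK (1 - 1 / r)) := by
  have hr0 : 0 < r := by linarith
  have hq : 0 < Real.sqrt r := Real.sqrt_pos.mpr hr0
  have hqq : Real.sqrt r ^ 2 = r := Real.sq_sqrt hr0.le
  set t₀ := 1 / Real.sqrt r with ht₀
  have ht₀0 : 0 < t₀ := by positivity
  have ht₀1 : t₀ < 1 := by
    rw [ht₀, div_lt_one hq, show (1 : ℝ) = Real.sqrt 1 from Real.sqrt_one.symm]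
    exact Real.sqrt_lt_sqrt zero_le_one hr
  have ht₀sq : r * t₀ ^ 2 = 1 := by rw [ht₀, div_pow, one_pow, hqq]; field_simp
  obtain ⟨hI1, hE1⟩ := integral_Ioo_inv_sqrt_lt hr
  obtain ⟨hI2, hE2⟩ := integral_Ioo_inv_sqrt_gt hr
  -- on `(0,t₀)` and on `(t₀,1)` the absolute value resolves
  have hlt : ∀ t ∈ Ioo (0 : ℝ) t₀, |1 - r * t ^ 2| = 1 - r * t ^ 2 := fun t ht => by
    apply abs_of_pos
    have : r * t ^ 2 < r * t₀ ^ 2 := by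
      apply mul_lt_mul_of_pos_left _ hr0
      exact pow_lt_pow_left₀ ht.2 ht.1.le two_ne_zero
    linarith
  have hgt : ∀ t ∈ Ioo t₀ (1 : ℝ), |1 - r * t ^ 2| = -(1 - r * t ^ 2) := fun t ht => by
    apply abs_of_neg
    have : r * t₀ ^ 2 < r * t ^ 2 := by
      apply mul_lt_mul_of_pos_left _ hr0
      exact pow_lt_pow_left₀ ht.1 ht₀0.le two_ne_zero
    linarith
  have hI1' : IntegrableOn (fun t : ℝ => 1 / Real.sqrt ((1 - t ^ 2) * |1 - r * t ^ 2|)) (Ioo 0 t₀) :=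
    hI1.congr_fun (fun t ht => by rw [hlt t ht]) measurableSet_Ioo
  have hI2' : IntegrableOn (fun t : ℝ => 1 / Real.sqrt ((1 - t ^ 2) * |1 - r * t ^ 2|)) (Ioo t₀ 1) :=
    hI2.congr_fun (fun t ht => by rw [hgt t ht]; ring_nf) measurableSet_Ioo
  have hI2'' : IntegrableOn (fun t : ℝ => 1 / Real.sqrt ((1 - t ^ 2) * |1 - r * t ^ 2|)) (Ico t₀ 1) :=
    (integrableOn_Ico_iff_integrableOn_Ioo).mpr hI2'
  have hU : Ioo (0 : ℝ) 1 = Ioo 0 t₀ ∪ Ico t₀ 1 := (Ioo_union_Ico_eq_Ioo ht₀0 ht₀1.le).symm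
  have hdisj : Disjoint (Ioo (0 : ℝ) t₀) (Ico t₀ 1) :=
    Set.disjoint_left.mpr fun x hx hx' => (not_le.mpr hx.2) hx'.1
  constructor
  · rw [hU]; exact hI1'.union hI2''
  · rw [hU, setIntegral_union hdisj measurableSet_Ico hI1' hI2'', integral_Ico_eq_integral_Ioo,
      setIntegral_congr_fun measurableSet_Ioo (fun t ht => by rw [hlt t ht]), hE1,
      setIntegral_congr_fun measurableSet_Ioo (fun t ht => by rw [hgt t ht])]
    have : ∫ t in Ioo t₀ 1, 1 / Real.sqrt ((1 - t ^ 2) * -(1 - r * t ^ 2)) =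
        ∫ t in Ioo t₀ 1, 1 / Real.sqrt ((1 - t ^ 2) * (r * t ^ 2 - 1)) :=
      setIntegral_congr_fun measurableSet_Ioo (fun t _ => by ring_nf)
    rw [this, hE2]
    ring

/-! ### The complete elliptic integral of complex parameter -/

section ComplexParameter

open Complex

/-- The parameter domain `ℂ ∖ [1, ∞)`. [folklore] -/
def kcDomain : Set ℂ := {m : ℂ | m.im ≠ 0 ∨ m.re < 1}

/-- The parameter domain is open. [folklore] -/
theorem isOpen_kcDomain : IsOpen kcDomain :=
  (isOpen_ne_fun Complex.continuous_im continuous_const).union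
    (isOpen_lt Complex.continuous_re continuous_const)

/-- The open lower half-plane lies in the parameter domain. [folklore] -/
theorem mem_kcDomain_of_im_neg {m : ℂ} (hm : m.im < 0) : m ∈ kcDomain := Or.inl hm.ne

/-- The open upper half-plane lies in the parameter domain. [folklore] -/
theorem mem_kcDomain_of_im_pos {m : ℂ} (hm : 0 < m.im) : m ∈ kcDomain := Or.inl hm.ne'

/-- Real parameters `x < 1` lie in the parameter domain. [folklore] -/
theorem ofReal_mem_kcDomain {x : ℝ} (hx : x < 1) : (x : ℂ) ∈ kcDomain := Or.inr (by simpa using hx)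

/-- A closed ball around a point of the (open) parameter domain inside it. [folklore] -/
theorem exists_closedBall_subset_kcDomain {m₀ : ℂ} (hm₀ : m₀ ∈ kcDomain) :
    ∃ ε > 0, Metric.closedBall m₀ ε ⊆ kcDomain := by
  obtain ⟨ε, hε, h⟩ := Metric.isOpen_iff.1 isOpen_kcDomain m₀ hm₀
  exact ⟨ε / 2, half_pos hε, (Metric.closedBall_subset_ball (half_lt_self hε)).trans h⟩

/-- Real and imaginary parts of `1 − m t²`. [folklore] -/
theorem one_sub_mul_re_im (m : ℂ) (t : ℝ) :
    (1 - m * ((t ^ 2 : ℝ) : ℂ)).re = 1 - m.re * t ^ 2 ∧ (1 - m * ((t ^ 2 : ℝ) : ℂ)).im = -(m.im * t ^ 2) := by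
  constructor
  · rw [Complex.sub_re, Complex.one_re, Complex.re_mul_ofReal]
  · rw [Complex.sub_im, Complex.one_im, Complex.im_mul_ofReal]; ring

/-- **Key branch fact**: for `m ∈ ℂ ∖ [1,∞)` and `0 ≤ t ≤ 1`, `1 − m t²` lies in the slit plane
`ℂ ∖ (−∞, 0]`. [folklore] -/
theorem one_sub_mul_mem_slitPlane {m : ℂ} (hm : m ∈ kcDomain) {t : ℝ} (ht : t ∈ Icc (0 : ℝ) 1) :
    1 - m * ((t ^ 2 : ℝ) : ℂ) ∈ slitPlane := by
  rw [mem_slitPlane_iff, (one_sub_mul_re_im m t).1, (one_sub_mul_re_im m t).2]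
  have ht2 : t ^ 2 ≤ 1 := by nlinarith [ht.1, ht.2]
  by_cases ht0 : t = 0
  · left; rw [ht0]; norm_num
  · have ht2' : 0 < t ^ 2 := by positivity
    rcases hm with h | h
    · right; exact neg_ne_zero.mpr (mul_ne_zero h ht2'.ne')
    · left
      rcases le_or_gt m.re 0 with h0 | h0
      · nlinarith [mul_nonneg (neg_nonneg.mpr h0) ht2'.le]
      · nlinarith [mul_le_mul_of_nonneg_left ht2 h0.le]

/-- The kernel `(1−t²)^{−1/2}(1 − m t²)^{−1/2}` (principal power) of the complete elliptic integral
of complex parameter `m`. [folklore] -/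
def kcKernel (m : ℂ) (t : ℝ) : ℂ :=
  (((1 - t ^ 2) ^ (-(1 / 2 : ℝ)) : ℝ) : ℂ) * (1 - m * ((t ^ 2 : ℝ) : ℂ)) ^ (-(1 / 2 : ℂ))

/-- The `m`-derivative `(1−t²)^{−1/2} · (t²/2)(1 − m t²)^{−3/2}` of the kernel. [folklore] -/
def kcKernelDeriv (m : ℂ) (t : ℝ) : ℂ :=
  (((1 - t ^ 2) ^ (-(1 / 2 : ℝ)) : ℝ) : ℂ) *
    (((t ^ 2 : ℝ) : ℂ) / 2 * (1 - m * ((t ^ 2 : ℝ) : ℂ)) ^ (-(3 / 2 : ℂ)))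

/-- **The complete elliptic integral of the first kind of complex parameter**,
`Kc(m) = ∫₀¹ (1−t²)^{−1/2}(1 − m t²)^{−1/2} dt` (principal branch), analytic on `ℂ ∖ [1,∞)` and equal
to `ellipticK m` for real `m < 1`. [cite: Zhou2013, eq. (inv_mod) (arXiv p. 18: "K(√z) = ∫₀¹ dt/(√(1−t²)√(1−zt²))")] -/
def Kc (m : ℂ) : ℂ := ∫ t in (0 : ℝ)..1, kcKernel m t

/-- The kernel is differentiable in the parameter, with the stated derivative. [folklore] -/
theorem hasDerivAt_kcKernel {m : ℂ} (hm : m ∈ kcDomain) {t : ℝ} (ht : t ∈ Icc (0 : ℝ) 1) :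
    HasDerivAt (fun m => kcKernel m t) (kcKernelDeriv m t) m := by
  have h1 : HasDerivAt (fun m : ℂ => 1 - m * ((t ^ 2 : ℝ) : ℂ)) (-((t ^ 2 : ℝ) : ℂ)) m :=
    (hasDerivAt_mul_const ((t ^ 2 : ℝ) : ℂ)).const_sub 1
  have h2 := h1.cpow_const (c := -(1 / 2 : ℂ)) (one_sub_mul_mem_slitPlane hm ht)
  have h3 := h2.const_mul (((1 - t ^ 2) ^ (-(1 / 2 : ℝ)) : ℝ) : ℂ)
  refine h3.congr_deriv ?_
  rw [kcKernelDeriv, show (-(1 / 2 : ℂ) - 1) = -(3 / 2 : ℂ) by norm_num]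
  ring

/-- Norm of the principal power `z^{−1/2}`: `‖z^{−1/2}‖ = ‖z‖^{−1/2}`. [folklore] -/
theorem norm_cpow_neg_half (z : ℂ) : ‖z ^ (-(1 / 2 : ℂ))‖ = ‖z‖ ^ (-(1 / 2 : ℝ)) := by
  rw [show (-(1 / 2 : ℂ)) = ((-(1 / 2) : ℝ) : ℂ) by push_cast; ring, norm_cpow_real]

/-- **Local uniform bounds**: near a point of the parameter domain, `‖(1 − m t²)^{−1/2}‖` and
`‖(t²/2)(1 − m t²)^{−3/2}‖` are bounded uniformly in `t ∈ [0,1]` (continuity of the principal powers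
on the slit plane, compactness). [folklore] -/
theorem exists_bound_kcKernel {m₀ : ℂ} (hm₀ : m₀ ∈ kcDomain) :
    ∃ ε > 0, Metric.closedBall m₀ ε ⊆ kcDomain ∧ ∃ C, ∀ m ∈ Metric.closedBall m₀ ε, ∀ t ∈ Icc (0 : ℝ) 1,
      ‖(1 - m * ((t ^ 2 : ℝ) : ℂ)) ^ (-(1 / 2 : ℂ))‖ ≤ C ∧
      ‖((t ^ 2 : ℝ) : ℂ) / 2 * (1 - m * ((t ^ 2 : ℝ) : ℂ)) ^ (-(3 / 2 : ℂ))‖ ≤ C := by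
  obtain ⟨ε, hε, hball⟩ := exists_closedBall_subset_kcDomain hm₀
  set S : Set ℂ := (fun p : ℝ × ℂ => 1 - p.2 * (((p.1 ^ 2 : ℝ)) : ℂ)) '' (Icc (0 : ℝ) 1 ×ˢ Metric.closedBall m₀ ε)
    with hS
  have hSc : IsCompact S :=
    (isCompact_Icc.prod (isCompact_closedBall m₀ ε)).image (by fun_prop)
  have hSsub : S ⊆ slitPlane := by
    rintro _ ⟨⟨t, m⟩, ⟨ht, hm⟩, rfl⟩
    exact one_sub_mul_mem_slitPlane (hball hm) ht
  have hc1 : ContinuousOn (fun z : ℂ => z ^ (-(1 / 2 : ℂ))) S := fun z hz =>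
    (continuousAt_id.cpow continuousAt_const (hSsub hz)).continuousWithinAt
  have hc2 : ContinuousOn (fun z : ℂ => z ^ (-(3 / 2 : ℂ))) S := fun z hz =>
    (continuousAt_id.cpow continuousAt_const (hSsub hz)).continuousWithinAt
  obtain ⟨C₁, hC₁⟩ := hSc.exists_bound_of_continuousOn hc1
  obtain ⟨C₂, hC₂⟩ := hSc.exists_bound_of_continuousOn hc2
  refine ⟨ε, hε, hball, max C₁ (max C₂ 0), fun m hm t ht => ?_⟩
  have hmem : 1 - m * ((t ^ 2 : ℝ) : ℂ) ∈ S := ⟨⟨t, m⟩, ⟨ht, hm⟩, rfl⟩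
  have ht2 : t ^ 2 ≤ 1 := by nlinarith [ht.1, ht.2]
  constructor
  · exact (hC₁ _ hmem).trans (le_max_left _ _)
  · rw [norm_mul, norm_div, Complex.norm_real, Real.norm_of_nonneg (sq_nonneg t), Complex.norm_two]
    calc t ^ 2 / 2 * ‖(1 - m * ((t ^ 2 : ℝ) : ℂ)) ^ (-(3 / 2 : ℂ))‖ ≤ 1 * max C₂ 0 := by
          apply mul_le_mul (by linarith) ((hC₂ _ hmem).trans (le_max_left _ _)) (norm_nonneg _)
            zero_le_one
      _ ≤ max C₁ (max C₂ 0) := by rw [one_mul]; exact le_max_right _ _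

/-- The singular weight `(1−t²)^{−1/2}` is `ellIntegrand 0 t` on `(−1,1)`. [folklore] -/
theorem rpow_neg_half_eq_ellIntegrand_zero {t : ℝ} (ht : t ∈ Ioo (-1 : ℝ) 1) :
    (1 - t ^ 2) ^ (-(1 / 2 : ℝ)) = ellIntegrand 0 t := by
  rw [ellIntegrand_eq_rpow one_pos ht]
  simp

/-- The singular weight is nonnegative. [folklore] -/
theorem rpow_neg_half_nonneg (t : ℝ) (ht : t ∈ Icc (0 : ℝ) 1) : 0 ≤ (1 - t ^ 2) ^ (-(1 / 2 : ℝ)) :=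
  Real.rpow_nonneg (by nlinarith [ht.1, ht.2]) _

/-- The kernel is measurable in `t`. [folklore] -/
theorem measurable_kcKernel (m : ℂ) : Measurable (kcKernel m) := by
  unfold kcKernel
  refine Measurable.mul (by fun_prop) ?_
  exact ((measurable_const.sub (measurable_const.mul (by fun_prop))).pow_const _)

/-- The derived kernel is measurable in `t`. [folklore] -/
theorem measurable_kcKernelDeriv (m : ℂ) : Measurable (kcKernelDeriv m) := by
  unfold kcKernelDeriv
  refine Measurable.mul (by fun_prop) (Measurable.mul (by fun_prop) ?_)
  exact ((measurable_const.sub (measurable_const.mul (by fun_prop))).pow_const _)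

/-- The integrable majorant `C · ellIntegrand 0`. [folklore] -/
theorem intervalIntegrable_const_mul_ellIntegrand_zero (C : ℝ) :
    IntervalIntegrable (fun t : ℝ => C * ellIntegrand 0 t) volume 0 1 :=
  (intervalIntegrable_ellIntegrand_of_lt_one one_pos).const_mul C

/-- Norm of the kernel: `‖kcKernel m t‖ = (1−t²)^{−1/2}‖(1−mt²)^{−1/2}‖` on `[0,1]`. [folklore] -/
theorem norm_kcKernel (m : ℂ) {t : ℝ} (ht : t ∈ Icc (0 : ℝ) 1) :
    ‖kcKernel m t‖ = (1 - t ^ 2) ^ (-(1 / 2 : ℝ)) * ‖(1 - m * ((t ^ 2 : ℝ) : ℂ)) ^ (-(1 / 2 : ℂ))‖ := by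
  rw [kcKernel, norm_mul, Complex.norm_real, Real.norm_of_nonneg (rpow_neg_half_nonneg t ht)]

/-- **Holomorphy of `Kc`.** On `ℂ ∖ [1,∞)`, `Kc` is complex differentiable with derivative
`∫₀¹ (1−t²)^{−1/2}(t²/2)(1 − m t²)^{−3/2} dt` (differentiation under the integral sign, dominated by
`C(1−t²)^{−1/2}`), and the kernel is integrable. [folklore] -/
theorem hasDerivAt_Kc {m₀ : ℂ} (hm₀ : m₀ ∈ kcDomain) :
    IntervalIntegrable (kcKernel m₀) volume 0 1 ∧
    HasDerivAt Kc (∫ t in (0 : ℝ)..1, kcKernelDeriv m₀ t) m₀ := by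
  obtain ⟨ε, hε, hball, C, hC⟩ := exists_bound_kcKernel hm₀
  have hball' : Metric.ball m₀ ε ⊆ Metric.closedBall m₀ ε := Metric.ball_subset_closedBall
  have hC0 : 0 ≤ C := (norm_nonneg _).trans (hC m₀ (Metric.mem_closedBall_self hε.le) 0 (by simp)).1
  -- integrability of the kernel at m₀
  have hint : IntervalIntegrable (kcKernel m₀) volume 0 1 := by
    refine (intervalIntegrable_const_mul_ellIntegrand_zero C).mono_fun'
      (measurable_kcKernel m₀).aestronglyMeasurable ?_
    rw [uIoc_of_le zero_le_one]
    refine (ae_restrict_mem measurableSet_Ioc).mono fun t ht => ?_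
    have ht' : t ∈ Icc (0 : ℝ) 1 := ⟨ht.1.le, ht.2⟩
    dsimp only
    rw [norm_kcKernel m₀ ht']
    rcases lt_or_eq_of_le ht.2 with h1 | h1
    · rw [rpow_neg_half_eq_ellIntegrand_zero ⟨by linarith [ht.1], h1⟩, mul_comm]
      exact mul_le_mul_of_nonneg_right (hC m₀ (Metric.mem_closedBall_self hε.le) t ht').1
        (ellIntegrand_nonneg 0 t)
    · subst h1
      simp [ellIntegrand]
  refine ⟨hint, ?_⟩
  have key := intervalIntegral.hasDerivAt_integral_of_dominated_loc_of_deriv_le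
    (μ := volume) (a := (0 : ℝ)) (b := 1) (F := kcKernel) (F' := kcKernelDeriv) (x₀ := m₀)
    (s := Metric.ball m₀ ε) (bound := fun t => C * ellIntegrand 0 t)
    (Metric.ball_mem_nhds m₀ hε)
    (Eventually.of_forall fun m => (measurable_kcKernel m).aestronglyMeasurable)
    hint (measurable_kcKernelDeriv m₀).aestronglyMeasurable ?_
    (intervalIntegrable_const_mul_ellIntegrand_zero C) ?_
  · exact key.2
  · refine Eventually.of_forall fun t ht m hm => ?_
    rw [uIoc_of_le zero_le_one] at ht
    have ht' : t ∈ Icc (0 : ℝ) 1 := ⟨ht.1.le, ht.2⟩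
    rw [kcKernelDeriv, norm_mul, Complex.norm_real, Real.norm_of_nonneg (rpow_neg_half_nonneg t ht')]
    rcases lt_or_eq_of_le ht.2 with h1 | h1
    · rw [rpow_neg_half_eq_ellIntegrand_zero ⟨by linarith [ht.1], h1⟩, mul_comm]
      exact mul_le_mul_of_nonneg_right (hC m (hball' hm) t ht').2 (ellIntegrand_nonneg 0 t)
    · subst h1
      simp [ellIntegrand]
  · refine Eventually.of_forall fun t ht m hm => ?_
    rw [uIoc_of_le zero_le_one] at ht
    exact hasDerivAt_kcKernel (hball (hball' hm)) ⟨ht.1.le, ht.2⟩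

/-- `Kc` is holomorphic on `ℂ ∖ [1,∞)`. [folklore] -/
theorem differentiableOn_Kc : DifferentiableOn ℂ Kc kcDomain := fun _ hm =>
  (hasDerivAt_Kc hm).2.differentiableAt.differentiableWithinAt

/-- `Kc` is differentiable at every point of `ℂ ∖ [1,∞)`. [folklore] -/
theorem differentiableAt_Kc {m : ℂ} (hm : m ∈ kcDomain) : DifferentiableAt ℂ Kc m :=
  (hasDerivAt_Kc hm).2.differentiableAt

/-- `Kc` is continuous at every point of `ℂ ∖ [1,∞)`. [folklore] -/
theorem continuousAt_Kc {m : ℂ} (hm : m ∈ kcDomain) : ContinuousAt Kc m :=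
  (differentiableAt_Kc hm).continuousAt

/-- **Real values**: for real `x < 1` and `0 < t < 1` the kernel is the real elliptic integrand,
`kcKernel x t = ellIntegrand x t`. [folklore] -/
theorem kcKernel_ofReal {x : ℝ} (hx : x < 1) {t : ℝ} (ht : t ∈ Ioo (0 : ℝ) 1) :
    kcKernel x t = (ellIntegrand x t : ℝ) := by
  have ht' : t ∈ Ioo (-1 : ℝ) 1 := ⟨by linarith [ht.1], ht.2⟩
  have h2 : 0 ≤ 1 - x * t ^ 2 := (one_sub_mul_sq_pos hx ht').le
  rw [kcKernel, show (-(1 / 2 : ℂ)) = ((-(1 / 2) : ℝ) : ℂ) by push_cast; ring,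
    show (1 : ℂ) - (x : ℂ) * ((t ^ 2 : ℝ) : ℂ) = ((1 - x * t ^ 2 : ℝ) : ℂ) by push_cast; ring,
    ← ofReal_cpow h2, ← ofReal_mul, ellIntegrand_eq_rpow hx ht']

/-- **`Kc = K` on `(−∞, 1)`**: for real `x < 1`, `Kc x = ellipticK x`. [folklore] -/
theorem Kc_ofReal {x : ℝ} (hx : x < 1) : Kc x = (ellipticK x : ℝ) := by
  rw [Kc, ellipticK_eq, intervalIntegral.integral_of_le zero_le_one,
    intervalIntegral.integral_of_le zero_le_one, integral_Ioc_eq_integral_Ioo,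
    integral_Ioc_eq_integral_Ioo, ← integral_complex_ofReal]
  exact setIntegral_congr_fun measurableSet_Ioo fun t ht => kcKernel_ofReal hx ht

/-- `Kc` as a set integral over `(0,1)`. [folklore] -/
theorem Kc_eq_setIntegral (m : ℂ) : Kc m = ∫ t in Ioo (0 : ℝ) 1, kcKernel m t := by
  rw [Kc, intervalIntegral.integral_of_le zero_le_one, integral_Ioc_eq_integral_Ioo]

/-! ### Values on the cut `(1, ∞)`: the inverse-modulus transformation -/

/-- `exp(−iπ/2) = −i`, in the form produced by `Complex.ofReal_cpow_of_nonpos`. [folklore] -/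
theorem exp_pi_mul_I_mul_neg_half : Complex.exp (π * I * (((-(1 / 2) : ℝ)) : ℂ)) = -I := by
  have : (π * I * (((-(1 / 2) : ℝ)) : ℂ)) = ((-(π / 2) : ℝ) : ℂ) * I := by push_cast; ring
  rw [this, Complex.exp_mul_I, ← Complex.ofReal_cos, ← Complex.ofReal_sin, Real.cos_neg, Real.sin_neg,
    Real.cos_pi_div_two, Real.sin_pi_div_two]
  simp

/-- `1/√(ab) = a^{−1/2} b^{−1/2}` for `a, b > 0`. [folklore] -/
theorem inv_sqrt_mul_eq_rpow {a b : ℝ} (ha : 0 < a) (hb : 0 < b) :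
    1 / Real.sqrt (a * b) = a ^ (-(1 / 2 : ℝ)) * b ^ (-(1 / 2 : ℝ)) := by
  have ha' : Real.sqrt a ≠ 0 := (Real.sqrt_pos.mpr ha).ne'
  have hb' : Real.sqrt b ≠ 0 := (Real.sqrt_pos.mpr hb).ne'
  rw [Real.rpow_neg ha.le, Real.rpow_neg hb.le, ← Real.sqrt_eq_rpow, ← Real.sqrt_eq_rpow,
    Real.sqrt_mul ha.le]
  field_simp

/-- On the cut, below the turning point: for `x > 1` and `0 < t < 1/√x` the kernel is real,
`kcKernel x t = 1/√((1−t²)(1−xt²))`. [cite: Zhou2013, eq. (inv_mod) (arXiv p. 18)] -/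
theorem kcKernel_ofReal_of_lt {x t : ℝ} (hx : 1 < x) (ht : t ∈ Ioo (0 : ℝ) (1 / Real.sqrt x)) :
    kcKernel x t = ((1 / Real.sqrt ((1 - t ^ 2) * (1 - x * t ^ 2)) : ℝ) : ℂ) := by
  have hx0 : 0 < x := by linarith
  have hq : 0 < Real.sqrt x := Real.sqrt_pos.mpr hx0
  have hqq : Real.sqrt x ^ 2 = x := Real.sq_sqrt hx0.le
  have ht1 : t < 1 := ht.2.trans ((div_lt_one hq).mpr (by
    rw [show (1 : ℝ) = Real.sqrt 1 from Real.sqrt_one.symm]; exact Real.sqrt_lt_sqrt zero_le_one hx))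
  have h1 : 0 < 1 - t ^ 2 := by nlinarith [ht.1]
  have h2 : 0 < 1 - x * t ^ 2 := by
    have : x * t ^ 2 < x * (1 / Real.sqrt x) ^ 2 :=
      mul_lt_mul_of_pos_left (pow_lt_pow_left₀ ht.2 ht.1.le two_ne_zero) hx0
    rw [div_pow, one_pow, hqq] at this
    have hx1 : x * (1 / x) = 1 := by field_simp
    linarith
  rw [kcKernel, show (-(1 / 2 : ℂ)) = ((-(1 / 2) : ℝ) : ℂ) by push_cast; ring,
    show (1 : ℂ) - (x : ℂ) * ((t ^ 2 : ℝ) : ℂ) = ((1 - x * t ^ 2 : ℝ) : ℂ) by push_cast; ring,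
    ← ofReal_cpow h2.le, ← ofReal_mul]
  congr 1
  exact (inv_sqrt_mul_eq_rpow h1 h2).symm

/-- On the cut, above the turning point: for `x > 1` and `1/√x < t < 1` the kernel is
`−i/√((1−t²)(xt²−1))` (principal branch: `(negative)^{−1/2} = e^{−iπ/2}·|·|^{−1/2}`).
[cite: Zhou2013, eq. (inv_mod) (arXiv p. 18: "√(1−zt²) = i√(zt²−1)")] -/
theorem kcKernel_ofReal_of_gt {x t : ℝ} (hx : 1 < x) (ht : t ∈ Ioo (1 / Real.sqrt x) (1 : ℝ)) :
    kcKernel x t = -I * ((1 / Real.sqrt ((1 - t ^ 2) * (x * t ^ 2 - 1)) : ℝ) : ℂ) := by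
  have hx0 : 0 < x := by linarith
  have hq : 0 < Real.sqrt x := Real.sqrt_pos.mpr hx0
  have hqq : Real.sqrt x ^ 2 = x := Real.sq_sqrt hx0.le
  have ht0 : 0 < t := lt_trans (by positivity) ht.1
  have h1 : 0 < 1 - t ^ 2 := by nlinarith [ht.2]
  have h2 : 0 < x * t ^ 2 - 1 := by
    have : x * (1 / Real.sqrt x) ^ 2 < x * t ^ 2 :=
      mul_lt_mul_of_pos_left (pow_lt_pow_left₀ ht.1 (by positivity) two_ne_zero) hx0
    rw [div_pow, one_pow, hqq] at this
    have hx1 : x * (1 / x) = 1 := by field_simp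
    linarith
  rw [kcKernel, show (-(1 / 2 : ℂ)) = ((-(1 / 2) : ℝ) : ℂ) by push_cast; ring,
    show (1 : ℂ) - (x : ℂ) * ((t ^ 2 : ℝ) : ℂ) = ((1 - x * t ^ 2 : ℝ) : ℂ) by push_cast; ring,
    ofReal_cpow_of_nonpos (by linarith : 1 - x * t ^ 2 ≤ 0), ← Complex.ofReal_neg,
    show -(1 - x * t ^ 2) = x * t ^ 2 - 1 by ring, ← ofReal_cpow h2.le, exp_pi_mul_I_mul_neg_half]
  rw [show ((((1 - t ^ 2) ^ (-(1 / 2 : ℝ)) : ℝ) : ℂ) * ((((x * t ^ 2 - 1) ^ (-(1 / 2 : ℝ)) : ℝ) : ℂ) * -I)) =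
      -I * (((1 - t ^ 2) ^ (-(1 / 2 : ℝ)) * (x * t ^ 2 - 1) ^ (-(1 / 2 : ℝ)) : ℝ) : ℂ) by push_cast; ring]
  congr 2
  exact (inv_sqrt_mul_eq_rpow h1 h2).symm

/-- **`Kc` on the cut** (inverse-modulus transformation, boundary value from below): for real
`x > 1`, `Kc x = x^{−1/2}(K(1/x) − i K(1−1/x))`, and the kernel is integrable on `(0,1)`.
[cite: Zhou2013, eq. (inv_mod) (arXiv p. 18: "K(√z) = [K(√(1/z)) − iK(√((z−1)/z))]/√z")] -/
theorem Kc_ofReal_of_one_lt {x : ℝ} (hx : 1 < x) :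
    IntegrableOn (kcKernel x) (Ioo 0 1) ∧
    Kc x = ((1 / Real.sqrt x * ellipticK (1 / x) : ℝ) : ℂ) -
      I * ((1 / Real.sqrt x * ellipticK (1 - 1 / x) : ℝ) : ℂ) := by
  have hx0 : 0 < x := by linarith
  have hq : 0 < Real.sqrt x := Real.sqrt_pos.mpr hx0
  set t₀ := 1 / Real.sqrt x with ht₀
  have ht₀0 : 0 < t₀ := by positivity
  have ht₀1 : t₀ < 1 := by
    rw [ht₀, div_lt_one hq, show (1 : ℝ) = Real.sqrt 1 from Real.sqrt_one.symm]
    exact Real.sqrt_lt_sqrt zero_le_one hx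
  obtain ⟨hI1, hE1⟩ := integral_Ioo_inv_sqrt_lt hx
  obtain ⟨hI2, hE2⟩ := integral_Ioo_inv_sqrt_gt hx
  have hU : Ioo (0 : ℝ) 1 = Ioo 0 t₀ ∪ Ico t₀ 1 := (Ioo_union_Ico_eq_Ioo ht₀0 ht₀1.le).symm
  have hdisj : Disjoint (Ioo (0 : ℝ) t₀) (Ico t₀ 1) :=
    Set.disjoint_left.mpr fun x hx hx' => (not_le.mpr hx.2) hx'.1
  -- the kernel on the two pieces
  have hK1 : IntegrableOn (kcKernel x) (Ioo 0 t₀) := by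
    have h : IntegrableOn (fun t : ℝ => (((1 / Real.sqrt ((1 - t ^ 2) * (1 - x * t ^ 2))) : ℝ) : ℂ))
        (Ioo 0 t₀) := hI1.ofReal (𝕜 := ℂ)
    exact h.congr_fun (fun t ht => (kcKernel_ofReal_of_lt hx ht).symm) measurableSet_Ioo
  have hK2 : IntegrableOn (kcKernel x) (Ioo t₀ 1) := by
    have h : IntegrableOn (fun t : ℝ => -I * (((1 / Real.sqrt ((1 - t ^ 2) * (x * t ^ 2 - 1))) : ℝ) : ℂ))
        (Ioo t₀ 1) := (hI2.ofReal (𝕜 := ℂ)).const_mul (-I)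
    exact h.congr_fun (fun t ht => (kcKernel_ofReal_of_gt hx ht).symm) measurableSet_Ioo
  have hK2' : IntegrableOn (kcKernel x) (Ico t₀ 1) := (integrableOn_Ico_iff_integrableOn_Ioo).mpr hK2
  constructor
  · rw [hU]; exact hK1.union hK2'
  · rw [Kc_eq_setIntegral, hU, setIntegral_union hdisj measurableSet_Ico hK1 hK2', integral_Ico_eq_integral_Ioo,
      setIntegral_congr_fun measurableSet_Ioo (fun t ht => kcKernel_ofReal_of_lt hx ht),
      setIntegral_congr_fun measurableSet_Ioo (fun t ht => kcKernel_ofReal_of_gt hx ht),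
      integral_complex_ofReal, integral_const_mul, integral_complex_ofReal, hE1, hE2]
    ring

/-! ### Norm bounds -/

/-- Pointwise bound of the kernel through a lower bound of `‖1 − m t²‖`: if
`0 < ρ ≤ ‖1 − m t²‖` then `‖kcKernel m t‖ ≤ (1−t²)^{−1/2} ρ^{−1/2}`. [folklore] -/
theorem norm_kcKernel_le {m : ℂ} {t ρ : ℝ} (ht : t ∈ Icc (0 : ℝ) 1) (hρ : 0 < ρ)
    (hle : ρ ≤ ‖1 - m * ((t ^ 2 : ℝ) : ℂ)‖) :
    ‖kcKernel m t‖ ≤ (1 - t ^ 2) ^ (-(1 / 2 : ℝ)) * ρ ^ (-(1 / 2 : ℝ)) := by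
  rw [norm_kcKernel m ht, norm_cpow_neg_half]
  exact mul_le_mul_of_nonneg_left (Real.rpow_le_rpow_of_nonpos hρ hle (by norm_num))
    (rpow_neg_half_nonneg t ht)

/-- `|1 − ‖m‖t²| ≤ ‖1 − m t²‖`. [folklore] -/
theorem abs_one_sub_norm_mul_le (m : ℂ) (t : ℝ) : |1 - ‖m‖ * t ^ 2| ≤ ‖1 - m * ((t ^ 2 : ℝ) : ℂ)‖ := by
  have h := abs_norm_sub_norm_le (1 : ℂ) (m * ((t ^ 2 : ℝ) : ℂ))
  rw [norm_one, norm_mul, Complex.norm_real, Real.norm_of_nonneg (sq_nonneg t)] at h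
  exact h

/-- `|1 − (Re m)t²| ≤ ‖1 − m t²‖`. [folklore] -/
theorem abs_one_sub_re_mul_le (m : ℂ) (t : ℝ) : |1 - m.re * t ^ 2| ≤ ‖1 - m * ((t ^ 2 : ℝ) : ℂ)‖ := by
  rw [← (one_sub_mul_re_im m t).1]
  exact Complex.abs_re_le_norm _

/-- The real majorant `(1−t²)^{−1/2}|1−rt²|^{−1/2} = 1/√((1−t²)|1−rt²|)` for `0 ≤ t < 1`, `rt² ≠ 1`.
[folklore] -/
theorem rpow_mul_rpow_eq_inv_sqrt {r t : ℝ} (ht : t ∈ Ico (0 : ℝ) 1) (hrt : 1 - r * t ^ 2 ≠ 0) :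
    (1 - t ^ 2) ^ (-(1 / 2 : ℝ)) * |1 - r * t ^ 2| ^ (-(1 / 2 : ℝ)) =
      1 / Real.sqrt ((1 - t ^ 2) * |1 - r * t ^ 2|) := by
  have h1 : 0 < 1 - t ^ 2 := by nlinarith [ht.1, ht.2]
  have h2 : 0 < |1 - r * t ^ 2| := abs_pos.mpr hrt
  exact (inv_sqrt_mul_eq_rpow h1 h2).symm

/-- **A.e. majorant of the kernel through `‖m‖`**: for `t ∈ (0,1)` with `‖m‖t² ≠ 1`,
`‖kcKernel m t‖ ≤ 1/√((1−t²)|1−‖m‖t²|)`. [folklore] -/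
theorem norm_kcKernel_le_norm {m : ℂ} {t : ℝ} (ht : t ∈ Ioo (0 : ℝ) 1) (hrt : 1 - ‖m‖ * t ^ 2 ≠ 0) :
    ‖kcKernel m t‖ ≤ 1 / Real.sqrt ((1 - t ^ 2) * |1 - ‖m‖ * t ^ 2|) := by
  rw [← rpow_mul_rpow_eq_inv_sqrt ⟨ht.1.le, ht.2⟩ hrt]
  exact norm_kcKernel_le ⟨ht.1.le, ht.2.le⟩ (abs_pos.mpr hrt) (abs_one_sub_norm_mul_le m t)

/-- **A.e. majorant of the kernel through `Re m`**: for `t ∈ (0,1)` with `(Re m)t² ≠ 1`,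
`‖kcKernel m t‖ ≤ 1/√((1−t²)|1−(Re m)t²|)`. [folklore] -/
theorem norm_kcKernel_le_re {m : ℂ} {t : ℝ} (ht : t ∈ Ioo (0 : ℝ) 1) (hrt : 1 - m.re * t ^ 2 ≠ 0) :
    ‖kcKernel m t‖ ≤ 1 / Real.sqrt ((1 - t ^ 2) * |1 - m.re * t ^ 2|) := by
  rw [← rpow_mul_rpow_eq_inv_sqrt ⟨ht.1.le, ht.2⟩ hrt]
  exact norm_kcKernel_le ⟨ht.1.le, ht.2.le⟩ (abs_pos.mpr hrt) (abs_one_sub_re_mul_le m t)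

/-- The exceptional point is a null set: for a.e. `t ∈ (0,1)`, `1 − r t² ≠ 0`. [folklore] -/
theorem ae_one_sub_mul_sq_ne_zero (r : ℝ) :
    ∀ᵐ t ∂(volume.restrict (Ioo (0 : ℝ) 1)), 1 - r * t ^ 2 ≠ 0 := by
  have hfin : ({t : ℝ | 1 - r * t ^ 2 = 0}).Finite := by
    refine Set.Finite.subset (Set.toFinite ({Real.sqrt (1 / r), -Real.sqrt (1 / r)} : Set ℝ)) ?_
    intro t ht
    simp only [Set.mem_setOf_eq] at ht
    have hr : r ≠ 0 := by rintro rfl; norm_num at ht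
    have h : t ^ 2 = 1 / r := by field_simp; linarith
    have habs : |t| = Real.sqrt (1 / r) := by rw [← Real.sqrt_sq_eq_abs, h]
    rcases (abs_eq (Real.sqrt_nonneg _)).mp habs with h1 | h1
    · simp [h1]
    · simp [h1]
  rw [ae_iff]
  simp only [ne_eq, not_not]
  exact hfin.measure_zero _

/-- **Bound through `‖m‖`**: for `‖m‖ > 1`, `‖Kc m‖ ≤ ‖m‖^{−1/2}(K(1/‖m‖) + K(1−1/‖m‖))`.
[folklore] -/
theorem norm_Kc_le_of_one_lt_norm {m : ℂ} (hm : 1 < ‖m‖) :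
    ‖Kc m‖ ≤ 1 / Real.sqrt ‖m‖ * (ellipticK (1 / ‖m‖) + ellipticK (1 - 1 / ‖m‖)) := by
  obtain ⟨hI, hE⟩ := integral_Ioo_inv_sqrt_abs hm
  rw [Kc_eq_setIntegral, ← hE]
  refine norm_integral_le_of_norm_le hI ?_
  filter_upwards [ae_restrict_mem measurableSet_Ioo, ae_one_sub_mul_sq_ne_zero ‖m‖] with t ht hne
  exact norm_kcKernel_le_norm ht hne

/-- **Bound through `Re m > 1`**: `‖Kc m‖ ≤ (Re m)^{−1/2}(K(1/Re m) + K(1−1/Re m))`. [folklore] -/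
theorem norm_Kc_le_of_one_lt_re {m : ℂ} (hm : 1 < m.re) :
    ‖Kc m‖ ≤ 1 / Real.sqrt m.re * (ellipticK (1 / m.re) + ellipticK (1 - 1 / m.re)) := by
  obtain ⟨hI, hE⟩ := integral_Ioo_inv_sqrt_abs hm
  rw [Kc_eq_setIntegral, ← hE]
  refine norm_integral_le_of_norm_le hI ?_
  filter_upwards [ae_restrict_mem measurableSet_Ioo, ae_one_sub_mul_sq_ne_zero m.re] with t ht hne
  exact norm_kcKernel_le_re ht hne

/-- **Bound through `Re m < 1`**: `‖Kc m‖ ≤ K(Re m)`. [folklore] -/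
theorem norm_Kc_le_of_re_lt_one {m : ℂ} (hm : m.re < 1) : ‖Kc m‖ ≤ ellipticK m.re := by
  have hI : IntegrableOn (ellIntegrand m.re) (Ioo 0 1) := by
    have h := intervalIntegrable_ellIntegrand_of_lt_one hm
    rwa [intervalIntegrable_iff_integrableOn_Ioo_of_le zero_le_one] at h
  rw [Kc_eq_setIntegral, ellipticK_eq, intervalIntegral.integral_of_le zero_le_one,
    integral_Ioc_eq_integral_Ioo]
  refine norm_integral_le_of_norm_le hI ?_
  filter_upwards [ae_restrict_mem measurableSet_Ioo] with t ht
  have hpos : 0 < 1 - m.re * t ^ 2 := one_sub_mul_sq_pos hm ⟨by linarith [ht.1], ht.2⟩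
  have h := norm_kcKernel_le_re (m := m) ht hpos.ne'
  rwa [abs_of_pos hpos] at h

/-- **Bound through `Re m ≤ 0`**: `‖Kc m‖ ≤ π/2`. [folklore] -/
theorem norm_Kc_le_of_re_nonpos {m : ℂ} (hm : m.re ≤ 0) : ‖Kc m‖ ≤ π / 2 :=
  (norm_Kc_le_of_re_lt_one (by linarith)).trans (ellipticK_zero ▸ ellipticK_mono hm zero_lt_one)

/-! ### Boundary values from below: vertical limits at real points -/

/-- The principal power `w ↦ w^c` is continuous within `{0 ≤ im}` at every nonzero real point.
[folklore] -/
theorem continuousWithinAt_cpow_const_ofReal {y : ℝ} (hy : y ≠ 0) (c : ℂ) :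
    ContinuousWithinAt (fun w : ℂ => w ^ c) {w : ℂ | 0 ≤ w.im} (y : ℂ) := by
  rcases lt_or_gt_of_ne hy with h | h
  · exact Literature.Analysis.FunctionSpaces.continuousWithinAt_cpow_const_of_re_neg
      (by simpa using h) (by simp) c
  · exact (continuousAt_id.cpow continuousAt_const (Or.inl (by simpa using h))).continuousWithinAt

/-- The vertical approach `ε ↦ y + a·ε·i` (`a ≥ 0`, `ε → 0⁺`) tends to `y` within `{0 ≤ im}`.
[folklore] -/
theorem tendsto_ofReal_add_mul_I (y a : ℝ) (ha : 0 ≤ a) :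
    Tendsto (fun ε : ℝ => (y : ℂ) + ((a * ε : ℝ) : ℂ) * I) (𝓝[>] 0) (𝓝[{w : ℂ | 0 ≤ w.im}] (y : ℂ)) := by
  rw [tendsto_nhdsWithin_iff]
  constructor
  · have h : Continuous fun ε : ℝ => (y : ℂ) + ((a * ε : ℝ) : ℂ) * I := by fun_prop
    have := h.tendsto 0
    simp only [mul_zero, Complex.ofReal_zero, zero_mul, add_zero] at this
    exact this.mono_left nhdsWithin_le_nhds
  · filter_upwards [self_mem_nhdsWithin] with ε hε
    have him : ((y : ℂ) + ((a * ε : ℝ) : ℂ) * I).im = a * ε := by simp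
    show 0 ≤ ((y : ℂ) + ((a * ε : ℝ) : ℂ) * I).im
    rw [him]
    exact mul_nonneg ha (le_of_lt hε)

/-- Pointwise vertical limit of the kernel at a real parameter `x` (`xt² ≠ 1`):
`kcKernel (x − εi) t → kcKernel x t` as `ε → 0⁺`. [folklore] -/
theorem tendsto_kcKernel_vertical {x t : ℝ} (hxt : 1 - x * t ^ 2 ≠ 0) :
    Tendsto (fun ε : ℝ => kcKernel ((x : ℂ) - (ε : ℂ) * I) t) (𝓝[>] 0) (𝓝 (kcKernel x t)) := by
  unfold kcKernel
  refine Tendsto.const_mul _ ?_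
  have hbase : ∀ ε : ℝ, (1 : ℂ) - ((x : ℂ) - (ε : ℂ) * I) * ((t ^ 2 : ℝ) : ℂ) =
      ((1 - x * t ^ 2 : ℝ) : ℂ) + ((t ^ 2 * ε : ℝ) : ℂ) * I := fun ε => by push_cast; ring
  have hbase0 : (1 : ℂ) - (x : ℂ) * ((t ^ 2 : ℝ) : ℂ) = ((1 - x * t ^ 2 : ℝ) : ℂ) := by push_cast; ring
  simp_rw [hbase, hbase0]
  exact ((continuousWithinAt_cpow_const_ofReal hxt _).tendsto).comp
    (tendsto_ofReal_add_mul_I (1 - x * t ^ 2) (t ^ 2) (sq_nonneg t))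

/-- **Vertical boundary limit of `Kc` on the cut**: for real `x > 1`,
`Kc(x − εi) → Kc(x)` as `ε → 0⁺` (dominated convergence with the majorant `1/√((1−t²)|1−xt²|)`,
which does not depend on `ε`). [cite: Zhou2013, Cor. 4.2 (arXiv p. 18: "we approach the limit of k ± i0⁺ ∈ [1,+∞), read off the real part")] -/
theorem tendsto_Kc_vertical_of_one_lt {x : ℝ} (hx : 1 < x) :
    Tendsto (fun ε : ℝ => Kc ((x : ℂ) - (ε : ℂ) * I)) (𝓝[>] 0) (𝓝 (Kc x)) := by
  simp_rw [Kc_eq_setIntegral]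
  refine tendsto_integral_filter_of_dominated_convergence
    (fun t => 1 / Real.sqrt ((1 - t ^ 2) * |1 - x * t ^ 2|))
    (Eventually.of_forall fun ε => (measurable_kcKernel _).aestronglyMeasurable) ?_
    (integral_Ioo_inv_sqrt_abs hx).1 ?_
  · refine Eventually.of_forall fun ε => ?_
    filter_upwards [ae_restrict_mem measurableSet_Ioo, ae_one_sub_mul_sq_ne_zero x] with t ht hne
    have h := norm_kcKernel_le_re (m := (x : ℂ) - (ε : ℂ) * I) ht (by simpa using hne)
    simpa using h
  · filter_upwards [ae_one_sub_mul_sq_ne_zero x] with t hne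
    exact tendsto_kcKernel_vertical hne

/-- **Vertical boundary limit of `Kc` off the cut**: for real `x < 1`, `Kc(x − εi) → Kc(x)`
(continuity). [folklore] -/
theorem tendsto_Kc_vertical_of_lt_one {x : ℝ} (hx : x < 1) :
    Tendsto (fun ε : ℝ => Kc ((x : ℂ) - (ε : ℂ) * I)) (𝓝[>] 0) (𝓝 (Kc x)) := by
  have h : Continuous fun ε : ℝ => (x : ℂ) - (ε : ℂ) * I := by fun_prop
  have h2 := h.tendsto 0
  simp only [Complex.ofReal_zero, zero_mul, sub_zero] at h2
  exact ((continuousAt_Kc (ofReal_mem_kcDomain hx)).tendsto.comp h2).mono_left nhdsWithin_le_nhds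

/-- Vertical boundary limit of `Kc` at every real `x ≠ 1`. [folklore] -/
theorem tendsto_Kc_vertical {x : ℝ} (hx : x ≠ 1) :
    Tendsto (fun ε : ℝ => Kc ((x : ℂ) - (ε : ℂ) * I)) (𝓝[>] 0) (𝓝 (Kc x)) := by
  rcases lt_or_gt_of_ne hx with h | h
  · exact tendsto_Kc_vertical_of_lt_one h
  · exact tendsto_Kc_vertical_of_one_lt h

/-! ### The Wick-rotation integrand `H = A³ (1 − m)^{−1/2}` -/

/-- `A(m) = Kc(m) + i·conj(Kc(1 − conj m))`: the analytic continuation of `K(m) + iK(1−m)` from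
`(0,1)` to the lower half `m`-plane. [cite: Zhou2013, Cor. 4.2 and eq. (inv_mod) (arXiv pp. 17–18)] -/
def wickA (m : ℂ) : ℂ := Kc m + I * (starRingEnd ℂ) (Kc (1 - (starRingEnd ℂ) m))

/-- The Wick-rotation integrand `H(m) = A(m)³ (1 − m)^{−1/2}`. [cite: Zhou2013, Prop. 5.1] -/
def wickH (m : ℂ) : ℂ := wickA m ^ 3 * (1 - m) ^ (-(1 / 2 : ℂ))

/-- `A` is complex differentiable on the open lower half-plane. [folklore] -/
theorem differentiableAt_wickA {m : ℂ} (hm : m.im < 0) : DifferentiableAt ℂ wickA m := by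
  unfold wickA
  refine (differentiableAt_Kc (mem_kcDomain_of_im_neg hm)).add (DifferentiableAt.const_mul ?_ I)
  -- `m ↦ conj (Kc (1 - conj m))` = `conj ∘ (Kc ∘ (1 - ·)) ∘ conj`
  have h1 : DifferentiableAt ℂ (fun w : ℂ => Kc (1 - w)) ((starRingEnd ℂ) m) := by
    have hmem : 1 - (starRingEnd ℂ) m ∈ kcDomain := by
      apply mem_kcDomain_of_im_neg
      simp only [Complex.sub_im, Complex.one_im, Complex.conj_im]
      linarith
    exact (differentiableAt_Kc hmem).comp _ ((differentiableAt_const _).sub differentiableAt_id)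
  have h2 := h1.conj_conj
  rw [Complex.conj_conj] at h2
  exact h2

/-- `H` is complex differentiable on the open lower half-plane. [folklore] -/
theorem differentiableAt_wickH {m : ℂ} (hm : m.im < 0) : DifferentiableAt ℂ wickH m := by
  unfold wickH
  refine ((differentiableAt_wickA hm).pow 3).mul ?_
  have hmem : (1 - m : ℂ) ∈ slitPlane := mem_slitPlane_iff.mpr (Or.inr (by simpa using hm.ne))
  exact ((differentiableAt_const _).sub differentiableAt_id).cpow (differentiableAt_const _) hmem

/-- `H` is holomorphic on the open lower half-plane. [folklore] -/
theorem differentiableOn_wickH : DifferentiableOn ℂ wickH {m : ℂ | m.im < 0} := fun _ hm =>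
  (differentiableAt_wickH hm).differentiableWithinAt

/-- `H` is continuous on the open lower half-plane. [folklore] -/
theorem continuousOn_wickH : ContinuousOn wickH {m : ℂ | m.im < 0} :=
  differentiableOn_wickH.continuousOn

/-- **Vertical boundary limit of `H`** at every real `x ∉ {0, 1}`:
`H(x − εi) → (Kc x + i conj(Kc(1−x)))³ (1−x)^{−1/2}` as `ε → 0⁺`. [folklore] -/
theorem tendsto_wickH_vertical {x : ℝ} (hx0 : x ≠ 0) (hx1 : x ≠ 1) :
    Tendsto (fun ε : ℝ => wickH ((x : ℂ) - (ε : ℂ) * I)) (𝓝[>] 0)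
      (𝓝 ((Kc x + I * (starRingEnd ℂ) (Kc ((1 - x : ℝ) : ℂ))) ^ 3 * (((1 - x : ℝ) : ℂ)) ^ (-(1 / 2 : ℂ)))) := by
  unfold wickH wickA
  refine Tendsto.mul (Tendsto.pow (Tendsto.add (tendsto_Kc_vertical hx1) (Tendsto.const_mul I ?_)) 3) ?_
  · -- the conjugated term: `1 - conj (x - εI) = (1 - x) - εI`
    have heq : ∀ ε : ℝ, (1 : ℂ) - (starRingEnd ℂ) ((x : ℂ) - (ε : ℂ) * I) = ((1 - x : ℝ) : ℂ) - (ε : ℂ) * I := by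
      intro ε
      simp only [map_sub, Complex.conj_ofReal, map_mul, Complex.conj_I]
      push_cast
      ring
    simp_rw [heq]
    exact (Complex.continuous_conj.tendsto _).comp (tendsto_Kc_vertical (x := 1 - x) (by
      intro h; apply hx0; linarith))
  · have heq : ∀ ε : ℝ, (1 : ℂ) - ((x : ℂ) - (ε : ℂ) * I) = ((1 - x : ℝ) : ℂ) + ((1 * ε : ℝ) : ℂ) * I := by
      intro ε; push_cast; ring
    simp_rw [heq]
    exact ((continuousWithinAt_cpow_const_ofReal (y := 1 - x) (sub_ne_zero.mpr (Ne.symm hx1)) _).tendsto).comp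
      (tendsto_ofReal_add_mul_I (1 - x) 1 zero_le_one)

/-! ### The boundary function and its real part -/

/-- The boundary function `H₀(x) = (Kc x + i conj(Kc(1−x)))³ (1−x)^{−1/2}` (real `x`; the vertical
limit of `H` from below at `x ∉ {0,1}`). [folklore] -/
def wickH₀ (x : ℝ) : ℂ :=
  (Kc x + I * (starRingEnd ℂ) (Kc ((1 - x : ℝ) : ℂ))) ^ 3 * (((1 - x : ℝ) : ℂ)) ^ (-(1 / 2 : ℂ))

/-- Algebra: `Re[(a + ib)³ w] = w(a³ − 3ab²)` for real `a, b, w`. [folklore] -/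
theorem re_cube_add_mul_I (a b w : ℝ) :
    (((a : ℂ) + I * (b : ℂ)) ^ 3 * (w : ℂ)).re = w * (a ^ 3 - 3 * a * b ^ 2) := by
  simp [pow_succ, Complex.mul_re, Complex.mul_im, Complex.add_re, Complex.add_im]
  ring

/-- **Real part on `(0,1)`**: `Re H₀(x) = (1−x)^{−1/2}(K(x)³ − 3K(x)K(1−x)²)`.
[cite: Zhou2013, Prop. 5.1] -/
theorem wickH₀_re_of_mem_Ioo {x : ℝ} (hx : x ∈ Ioo (0 : ℝ) 1) :
    (wickH₀ x).re = (1 - x) ^ (-(1 / 2 : ℝ)) * (ellipticK x ^ 3 - 3 * ellipticK x * ellipticK (1 - x) ^ 2) := by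
  have h1 : (1 - x : ℝ) < 1 := by linarith [hx.1]
  have h1' : 0 ≤ 1 - x := by linarith [hx.2]
  rw [wickH₀, Kc_ofReal hx.2, Kc_ofReal h1, Complex.conj_ofReal,
    show (-(1 / 2 : ℂ)) = ((-(1 / 2) : ℝ) : ℂ) by push_cast; ring, ← ofReal_cpow h1',
    re_cube_add_mul_I]

/-- The imaginary-modulus transformation, rewritten: for `x > 1`, `K(1−x) = x^{−1/2}K(1−1/x)`.
[cite: Zhou2013, §4.1 (imaginary modulus transformation)] -/
theorem ellipticK_one_sub_of_one_lt {x : ℝ} (hx : 1 < x) :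
    ellipticK (1 - x) = 1 / Real.sqrt x * ellipticK (1 - 1 / x) := by
  have h := ellipticK_neg (μ := x - 1) (by linarith)
  rw [show -(x - 1) = 1 - x by ring, show 1 + (x - 1) = x by ring] at h
  rw [h]
  congr 2
  field_simp

/-- The imaginary-modulus transformation, rewritten: for `x < 0`,
`K(x) = (1−x)^{−1/2}K(1 − 1/(1−x))`. [cite: Zhou2013, §4.1 (imaginary modulus transformation)] -/
theorem ellipticK_of_neg {x : ℝ} (hx : x < 0) :
    ellipticK x = 1 / Real.sqrt (1 - x) * ellipticK (1 - 1 / (1 - x)) := by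
  have h := ellipticK_neg (μ := -x) (by linarith)
  rw [neg_neg, show 1 + -x = 1 - x by ring] at h
  rw [h]
  congr 2
  have : (1 - x) ≠ 0 := by linarith
  field_simp
  ring

/-- **Real part on `(1,∞)` vanishes**: there `A = Kc x + i conj(Kc(1−x)) = x^{−1/2}K(1/x)` is real
and `(1−x)^{−1/2} = −i(x−1)^{−1/2}`. [cite: Zhou2013, Cor. 4.2 and eq. (inv_mod) (arXiv p. 18)] -/
theorem wickH₀_re_of_one_lt {x : ℝ} (hx : 1 < x) : (wickH₀ x).re = 0 := by
  have hx0 : 0 ≤ x - 1 := by linarith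
  have h1 : (1 - x : ℝ) < 1 := by linarith
  obtain ⟨-, hK⟩ := Kc_ofReal_of_one_lt hx
  have hA : Kc x + I * (starRingEnd ℂ) (Kc ((1 - x : ℝ) : ℂ)) = ((1 / Real.sqrt x * ellipticK (1 / x) : ℝ) : ℂ) := by
    rw [hK, Kc_ofReal h1, Complex.conj_ofReal, ellipticK_one_sub_of_one_lt hx]
    ring
  have hw : (((1 - x : ℝ) : ℂ)) ^ (-(1 / 2 : ℂ)) = (((x - 1) ^ (-(1 / 2 : ℝ)) : ℝ) : ℂ) * (-I) := by
    rw [show (-(1 / 2 : ℂ)) = ((-(1 / 2) : ℝ) : ℂ) by push_cast; ring,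
      ofReal_cpow_of_nonpos (by linarith : (1 - x : ℝ) ≤ 0), ← Complex.ofReal_neg,
      show -(1 - x) = x - 1 by ring, ← ofReal_cpow hx0, exp_pi_mul_I_mul_neg_half]
  rw [wickH₀, hA, hw]
  have e : (((1 / Real.sqrt x * ellipticK (1 / x) : ℝ) : ℂ) ^ 3 *
      ((((x - 1) ^ (-(1 / 2 : ℝ)) : ℝ) : ℂ) * -I)) =
      ((-((1 / Real.sqrt x * ellipticK (1 / x)) ^ 3 * (x - 1) ^ (-(1 / 2 : ℝ))) : ℝ) : ℂ) * I := by
    push_cast; ring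
  rw [e, Complex.re_ofReal_mul, Complex.I_re, mul_zero]

/-- **Real part on `(−∞,0)` vanishes**: there `A = i(1−x)^{−1/2}K(1/(1−x))` is purely imaginary and
`(1−x)^{−1/2}` is real. [cite: Zhou2013, Cor. 4.2 and eq. (inv_mod) (arXiv p. 18)] -/
theorem wickH₀_re_of_neg {x : ℝ} (hx : x < 0) : (wickH₀ x).re = 0 := by
  have hx1 : (1 : ℝ) < 1 - x := by linarith
  have h1' : 0 ≤ 1 - x := by linarith
  obtain ⟨-, hK⟩ := Kc_ofReal_of_one_lt hx1
  have hA : Kc x + I * (starRingEnd ℂ) (Kc ((1 - x : ℝ) : ℂ)) =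
      I * ((1 / Real.sqrt (1 - x) * ellipticK (1 / (1 - x)) : ℝ) : ℂ) := by
    rw [hK, Kc_ofReal (by linarith : x < 1), ellipticK_of_neg hx]
    simp only [map_sub, map_mul, Complex.conj_ofReal, Complex.conj_I]
    linear_combination ((1 / Real.sqrt (1 - x) * ellipticK (1 - 1 / (1 - x)) : ℝ) : ℂ) * Complex.I_mul_I
  have hw : (((1 - x : ℝ) : ℂ)) ^ (-(1 / 2 : ℂ)) = (((1 - x) ^ (-(1 / 2 : ℝ)) : ℝ) : ℂ) := by
    rw [show (-(1 / 2 : ℂ)) = ((-(1 / 2) : ℝ) : ℂ) by push_cast; ring, ← ofReal_cpow h1']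
  rw [wickH₀, hA, hw]
  simp [pow_succ, Complex.mul_re, Complex.mul_im]

/-! ### Decay at infinity -/

/-- `1/√r = r^{−1/2}` for `r ≥ 0`. [folklore] -/
theorem one_div_sqrt_eq_rpow {r : ℝ} (hr : 0 ≤ r) : 1 / Real.sqrt r = r ^ (-(1 / 2 : ℝ)) := by
  rw [Real.rpow_neg hr, ← Real.sqrt_eq_rpow, one_div (Real.sqrt r)]

/-- **Decay of `Kc`**: `‖Kc m‖ ≤ C‖m‖^{−3/8}` for `‖m‖ ≥ 2`, with `C = K(1/2) + 8`. [folklore] -/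
theorem norm_Kc_le_rpow_of_two_le {m : ℂ} (hm : 2 ≤ ‖m‖) :
    ‖Kc m‖ ≤ (ellipticK (1 / 2) + 8) * ‖m‖ ^ (-(3 / 8 : ℝ)) := by
  have hK0 : 0 ≤ ellipticK (1 / 2) := ellipticK_nonneg _
  set r := ‖m‖ with hr
  have hr1 : 1 < r := by linarith
  have hr0 : 0 < r := by linarith
  have h := norm_Kc_le_of_one_lt_norm (m := m) hr1
  rw [← hr] at h
  have h1 : ellipticK (1 / r) ≤ ellipticK (1 / 2) :=
    ellipticK_mono (one_div_le_one_div_of_le (by norm_num) hm) (by norm_num)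
  have h2 : ellipticK (1 - 1 / r) ≤ 8 * r ^ (1 / 8 : ℝ) := by
    have hlt : 1 / r < 1 := (div_lt_one hr0).mpr hr1
    have hpos : 0 < 1 / r := by positivity
    have h := ellipticK_le_rpow (u := 1 - 1 / r) (θ := 1 / 4) (by linarith) (by linarith)
      (by norm_num) (by norm_num)
    have e : (1 - (1 - 1 / r)) ^ (-((1 / 4 : ℝ) / 2)) = r ^ (1 / 8 : ℝ) := by
      rw [sub_sub_cancel, one_div r, Real.inv_rpow hr0.le, ← Real.rpow_neg hr0.le]
      norm_num
    rw [e, show (2 : ℝ) / (1 / 4) = 8 by norm_num] at h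
    exact h
  have e1 : 1 / Real.sqrt r = r ^ (-(1 / 2 : ℝ)) := one_div_sqrt_eq_rpow hr0.le
  have e2 : r ^ (-(1 / 2 : ℝ)) * r ^ (1 / 8 : ℝ) = r ^ (-(3 / 8 : ℝ)) := by
    rw [← Real.rpow_add hr0]; norm_num
  have e3 : r ^ (-(1 / 2 : ℝ)) ≤ r ^ (-(3 / 8 : ℝ)) :=
    Real.rpow_le_rpow_of_exponent_le hr1.le (by norm_num)
  calc ‖Kc m‖ ≤ 1 / Real.sqrt r * (ellipticK (1 / r) + ellipticK (1 - 1 / r)) := h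
    _ ≤ r ^ (-(1 / 2 : ℝ)) * (ellipticK (1 / 2) + 8 * r ^ (1 / 8 : ℝ)) := by
        rw [e1]; exact mul_le_mul_of_nonneg_left (add_le_add h1 h2) (Real.rpow_nonneg hr0.le _)
    _ = ellipticK (1 / 2) * r ^ (-(1 / 2 : ℝ)) + 8 * (r ^ (-(1 / 2 : ℝ)) * r ^ (1 / 8 : ℝ)) := by ring
    _ ≤ ellipticK (1 / 2) * r ^ (-(3 / 8 : ℝ)) + 8 * r ^ (-(3 / 8 : ℝ)) := by
        rw [e2]; exact add_le_add (mul_le_mul_of_nonneg_left e3 hK0) le_rfl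
    _ = (ellipticK (1 / 2) + 8) * r ^ (-(3 / 8 : ℝ)) := by ring

/-- **Decay of `A`**: `‖A(m)‖ ≤ C‖m‖^{−3/8}` for `‖m‖ ≥ 4`. [folklore] -/
theorem norm_wickA_le_rpow_of_four_le {m : ℂ} (hm : 4 ≤ ‖m‖) :
    ‖wickA m‖ ≤ (ellipticK (1 / 2) + 8) * (1 + (2 : ℝ) ^ (3 / 8 : ℝ)) * ‖m‖ ^ (-(3 / 8 : ℝ)) := by
  set C := ellipticK (1 / 2) + 8 with hC
  have hC0 : 0 ≤ C := by have := ellipticK_nonneg (1 / 2); positivity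
  have hr0 : 0 < ‖m‖ := by linarith
  have h1m : ‖m‖ / 2 ≤ ‖1 - (starRingEnd ℂ) m‖ := by
    have h := norm_sub_norm_le ((starRingEnd ℂ) m) 1
    rw [Complex.norm_conj, norm_one, ← norm_neg ((starRingEnd ℂ) m - 1), neg_sub] at h
    linarith
  have h1m2 : 2 ≤ ‖1 - (starRingEnd ℂ) m‖ := by linarith
  have hA1 := norm_Kc_le_rpow_of_two_le (m := m) (by linarith)
  have hA2 := norm_Kc_le_rpow_of_two_le h1m2
  have hmono : ‖1 - (starRingEnd ℂ) m‖ ^ (-(3 / 8 : ℝ)) ≤ (‖m‖ / 2) ^ (-(3 / 8 : ℝ)) :=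
    Real.rpow_le_rpow_of_nonpos (by positivity) h1m (by norm_num)
  have hsplit : (‖m‖ / 2) ^ (-(3 / 8 : ℝ)) = (2 : ℝ) ^ (3 / 8 : ℝ) * ‖m‖ ^ (-(3 / 8 : ℝ)) := by
    rw [div_eq_mul_inv, Real.mul_rpow hr0.le (by norm_num), Real.inv_rpow (by norm_num),
      ← Real.rpow_neg (by norm_num), neg_neg, mul_comm]
  unfold wickA
  calc ‖Kc m + I * (starRingEnd ℂ) (Kc (1 - (starRingEnd ℂ) m))‖
        ≤ ‖Kc m‖ + ‖I * (starRingEnd ℂ) (Kc (1 - (starRingEnd ℂ) m))‖ := norm_add_le _ _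
    _ = ‖Kc m‖ + ‖Kc (1 - (starRingEnd ℂ) m)‖ := by
        rw [norm_mul, Complex.norm_I, one_mul, Complex.norm_conj]
    _ ≤ C * ‖m‖ ^ (-(3 / 8 : ℝ)) + C * ‖1 - (starRingEnd ℂ) m‖ ^ (-(3 / 8 : ℝ)) := add_le_add hA1 hA2
    _ ≤ C * ‖m‖ ^ (-(3 / 8 : ℝ)) + C * ((2 : ℝ) ^ (3 / 8 : ℝ) * ‖m‖ ^ (-(3 / 8 : ℝ))) := by
        rw [← hsplit]; exact add_le_add le_rfl (mul_le_mul_of_nonneg_left hmono hC0)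
    _ = C * (1 + (2 : ℝ) ^ (3 / 8 : ℝ)) * ‖m‖ ^ (-(3 / 8 : ℝ)) := by ring

/-- The decay constant of `H`. [folklore] -/
def wickDecayConst : ℝ :=
  ((ellipticK (1 / 2) + 8) * (1 + (2 : ℝ) ^ (3 / 8 : ℝ))) ^ 3 * (2 : ℝ) ^ (1 / 2 : ℝ)

/-- The decay constant is nonnegative. [folklore] -/
theorem wickDecayConst_nonneg : 0 ≤ wickDecayConst := by
  unfold wickDecayConst
  have := ellipticK_nonneg (1 / 2)
  positivity

/-- **Decay of `H`**: `‖H(m)‖ ≤ C‖m‖^{−13/8}` for `‖m‖ ≥ 4` (any `m`, on or off the cuts).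
[folklore] -/
theorem norm_wickH_le_rpow_of_four_le {m : ℂ} (hm : 4 ≤ ‖m‖) :
    ‖wickH m‖ ≤ wickDecayConst * ‖m‖ ^ (-(13 / 8 : ℝ)) := by
  set C := (ellipticK (1 / 2) + 8) * (1 + (2 : ℝ) ^ (3 / 8 : ℝ)) with hC
  have hC0 : 0 ≤ C := by have := ellipticK_nonneg (1 / 2); positivity
  have hr0 : 0 < ‖m‖ := by linarith
  have hA := norm_wickA_le_rpow_of_four_le hm
  rw [← hC] at hA
  have hA0 : 0 ≤ ‖wickA m‖ := norm_nonneg _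
  have h1m : ‖m‖ / 2 ≤ ‖1 - m‖ := by
    have h := norm_sub_norm_le m 1
    rw [norm_one, ← norm_neg (m - 1), neg_sub] at h
    linarith
  have hw : ‖(1 - m) ^ (-(1 / 2 : ℂ))‖ ≤ (2 : ℝ) ^ (1 / 2 : ℝ) * ‖m‖ ^ (-(1 / 2 : ℝ)) := by
    rw [norm_cpow_neg_half]
    calc ‖1 - m‖ ^ (-(1 / 2 : ℝ)) ≤ (‖m‖ / 2) ^ (-(1 / 2 : ℝ)) :=
          Real.rpow_le_rpow_of_nonpos (by positivity) h1m (by norm_num)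
      _ = (2 : ℝ) ^ (1 / 2 : ℝ) * ‖m‖ ^ (-(1 / 2 : ℝ)) := by
          rw [div_eq_mul_inv, Real.mul_rpow hr0.le (by norm_num), Real.inv_rpow (by norm_num),
            ← Real.rpow_neg (by norm_num), neg_neg, mul_comm]
  have hpow : ‖wickA m‖ ^ 3 ≤ (C * ‖m‖ ^ (-(3 / 8 : ℝ))) ^ 3 := pow_le_pow_left₀ hA0 hA 3
  have e : (C * ‖m‖ ^ (-(3 / 8 : ℝ))) ^ 3 * ((2 : ℝ) ^ (1 / 2 : ℝ) * ‖m‖ ^ (-(1 / 2 : ℝ))) =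
      wickDecayConst * ‖m‖ ^ (-(13 / 8 : ℝ)) := by
    rw [wickDecayConst, ← hC, mul_pow, ← Real.rpow_natCast (‖m‖ ^ (-(3 / 8 : ℝ))),
      ← Real.rpow_mul hr0.le]
    have : ‖m‖ ^ (-(3 / 8 : ℝ) * ((3 : ℕ) : ℝ)) * ‖m‖ ^ (-(1 / 2 : ℝ)) = ‖m‖ ^ (-(13 / 8 : ℝ)) := by
      rw [← Real.rpow_add hr0]; norm_num
    rw [← this]
    ring
  rw [wickH, norm_mul, norm_pow, ← e]
  exact mul_le_mul hpow hw (norm_nonneg _) (by positivity)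

/-! ### Cauchy's theorem: the integral of `H` along horizontal lines below the axis vanishes -/

/-- The integrable envelope `(1 + |x|)^{−13/8}` on `ℝ`. [folklore] -/
theorem integrable_one_add_abs_rpow : Integrable (fun x : ℝ => (1 + ‖x‖) ^ (-(13 / 8 : ℝ))) :=
  integrable_one_add_norm (by rw [Module.finrank_self]; norm_num)

/-- `x ↦ H(x − δi)` is continuous for `δ > 0`. [folklore] -/
theorem continuous_wickH_horizontal {δ : ℝ} (hδ : 0 < δ) :
    Continuous fun x : ℝ => wickH ((x : ℂ) - (δ : ℂ) * I) :=
  continuousOn_wickH.comp_continuous (by fun_prop) fun x => by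
    show ((x : ℂ) - (δ : ℂ) * I).im < 0
    simp [hδ]

/-- Norm of a point on a horizontal line: `|x| ≤ ‖x − δi‖`. [folklore] -/
theorem abs_le_norm_sub_mul_I (x δ : ℝ) : |x| ≤ ‖(x : ℂ) - (δ : ℂ) * I‖ := by
  have h := Complex.abs_re_le_norm ((x : ℂ) - (δ : ℂ) * I)
  simpa using h

/-- Norm of a point on a horizontal line: `|δ| ≤ ‖x − δi‖`. [folklore] -/
theorem abs_le_norm_sub_mul_I' (x δ : ℝ) : |δ| ≤ ‖(x : ℂ) - (δ : ℂ) * I‖ := by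
  have h := Complex.abs_im_le_norm ((x : ℂ) - (δ : ℂ) * I)
  simpa using h

/-- **Integrability along horizontal lines**: for `δ > 0`, `x ↦ H(x − δi)` is integrable on `ℝ`
(continuous, and `O(|x|^{−13/8})`). [folklore] -/
theorem integrable_wickH_horizontal {δ : ℝ} (hδ : 0 < δ) :
    Integrable (fun x : ℝ => wickH ((x : ℂ) - (δ : ℂ) * I)) := by
  have hcont := continuous_wickH_horizontal hδ
  obtain ⟨M, hM⟩ := isCompact_Icc.exists_bound_of_continuousOn (hcont.continuousOn (s := Icc (-4 : ℝ) 4))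
  have hM0 : 0 ≤ M := (norm_nonneg _).trans (hM 0 (by norm_num))
  set C₁ := M * (5 : ℝ) ^ (13 / 8 : ℝ) + wickDecayConst * (4 / 5 : ℝ) ^ (-(13 / 8 : ℝ)) with hC₁
  refine (integrable_one_add_abs_rpow.const_mul C₁).mono' hcont.aestronglyMeasurable
    (Eventually.of_forall fun x => ?_)
  have h1x : 0 < 1 + ‖x‖ := by positivity
  rw [Real.norm_eq_abs] at h1x ⊢
  rcases le_or_gt |x| 4 with hx | hx
  · -- |x| ≤ 4: continuity bound
    have hb := hM x (abs_le.mp hx)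
    have h5 : (1 : ℝ) ≤ (5 : ℝ) ^ (13 / 8 : ℝ) * (1 + |x|) ^ (-(13 / 8 : ℝ)) := by
      have : (1 + |x|) ^ (-(13 / 8 : ℝ)) ≥ (5 : ℝ) ^ (-(13 / 8 : ℝ)) :=
        Real.rpow_le_rpow_of_nonpos h1x (by linarith) (by norm_num)
      calc (1 : ℝ) = (5 : ℝ) ^ (13 / 8 : ℝ) * (5 : ℝ) ^ (-(13 / 8 : ℝ)) := by
            rw [← Real.rpow_add (by norm_num)]; norm_num
        _ ≤ (5 : ℝ) ^ (13 / 8 : ℝ) * (1 + |x|) ^ (-(13 / 8 : ℝ)) :=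
            mul_le_mul_of_nonneg_left this (by positivity)
    calc ‖wickH ((x : ℂ) - (δ : ℂ) * I)‖ ≤ M * 1 := by rw [mul_one]; exact hb
      _ ≤ M * ((5 : ℝ) ^ (13 / 8 : ℝ) * (1 + |x|) ^ (-(13 / 8 : ℝ))) := mul_le_mul_of_nonneg_left h5 hM0
      _ ≤ C₁ * (1 + |x|) ^ (-(13 / 8 : ℝ)) := by
          rw [hC₁]
          have : 0 ≤ wickDecayConst * (4 / 5 : ℝ) ^ (-(13 / 8 : ℝ)) * (1 + |x|) ^ (-(13 / 8 : ℝ)) := by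
            have := wickDecayConst_nonneg; positivity
          nlinarith
  · -- |x| > 4: decay bound
    have hnorm : 4 ≤ ‖(x : ℂ) - (δ : ℂ) * I‖ := hx.le.trans (abs_le_norm_sub_mul_I x δ)
    have hb := norm_wickH_le_rpow_of_four_le hnorm
    have hx0 : 0 < |x| := by linarith
    have h2 : ‖(x : ℂ) - (δ : ℂ) * I‖ ^ (-(13 / 8 : ℝ)) ≤ |x| ^ (-(13 / 8 : ℝ)) :=
      Real.rpow_le_rpow_of_nonpos hx0 (abs_le_norm_sub_mul_I x δ) (by norm_num)
    have h3 : |x| ^ (-(13 / 8 : ℝ)) ≤ (4 / 5 : ℝ) ^ (-(13 / 8 : ℝ)) * (1 + |x|) ^ (-(13 / 8 : ℝ)) := by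
      have h45 : (4 / 5 : ℝ) * (1 + |x|) ≤ |x| := by linarith
      calc |x| ^ (-(13 / 8 : ℝ)) ≤ ((4 / 5 : ℝ) * (1 + |x|)) ^ (-(13 / 8 : ℝ)) :=
            Real.rpow_le_rpow_of_nonpos (by positivity) h45 (by norm_num)
        _ = (4 / 5 : ℝ) ^ (-(13 / 8 : ℝ)) * (1 + |x|) ^ (-(13 / 8 : ℝ)) :=
            Real.mul_rpow (by norm_num) h1x.le
    calc ‖wickH ((x : ℂ) - (δ : ℂ) * I)‖ ≤ wickDecayConst * ‖(x : ℂ) - (δ : ℂ) * I‖ ^ (-(13 / 8 : ℝ)) := hb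
      _ ≤ wickDecayConst * ((4 / 5 : ℝ) ^ (-(13 / 8 : ℝ)) * (1 + |x|) ^ (-(13 / 8 : ℝ))) :=
          mul_le_mul_of_nonneg_left (h2.trans h3) wickDecayConst_nonneg
      _ ≤ C₁ * (1 + |x|) ^ (-(13 / 8 : ℝ)) := by
          rw [hC₁]
          have : 0 ≤ M * (5 : ℝ) ^ (13 / 8 : ℝ) * (1 + |x|) ^ (-(13 / 8 : ℝ)) := by positivity
          nlinarith

/-- **Cauchy–Goursat on the rectangle `[−R, R] × [−c, −ε]`** for `H`. [folklore] -/
theorem wickH_boundary_rect {ε c : ℝ} (hε : 0 < ε) (hεc : ε ≤ c) (R : ℝ) :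
    (∫ x : ℝ in -R..R, wickH (x + (-c : ℝ) * I)) - (∫ x : ℝ in -R..R, wickH (x + (-ε : ℝ) * I)) +
      I • (∫ y : ℝ in (-c)..(-ε), wickH (R + y * I)) -
      I • (∫ y : ℝ in (-c)..(-ε), wickH ((-R : ℝ) + y * I)) = 0 := by
  have h := Complex.integral_boundary_rect_eq_zero_of_differentiableOn wickH ⟨-R, -c⟩ ⟨R, -ε⟩ ?_
  · simpa using h
  · intro m hm
    refine (differentiableAt_wickH ?_).differentiableWithinAt
    have him : m.im ∈ uIcc (-c) (-ε) := hm.2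
    rw [uIcc_of_le (by linarith)] at him
    linarith [him.2]

/-- The vertical sides of the rectangle vanish as `R → ∞`. [folklore] -/
theorem tendsto_wickH_side (ε c : ℝ) (s : ℝ) (hs : s = 1 ∨ s = -1) :
    Tendsto (fun R : ℝ => ∫ y : ℝ in (-c)..(-ε), wickH ((s * R : ℝ) + y * I)) atTop (𝓝 0) := by
  have hlim : Tendsto (fun R : ℝ => wickDecayConst * |(-ε) - (-c)| * R ^ (-(13 / 8 : ℝ))) atTop (𝓝 0) := by
    have h := (tendsto_rpow_neg_atTop (by norm_num : (0 : ℝ) < 13 / 8)).const_mul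
      (wickDecayConst * |(-ε) - (-c)|)
    rw [mul_zero] at h
    exact h
  refine squeeze_zero_norm' ?_ hlim
  · filter_upwards [eventually_ge_atTop (4 : ℝ)] with R hR
    have hR0 : 0 < R := by linarith
    have hpt : ∀ y ∈ Ι (-c) (-ε), ‖wickH ((s * R : ℝ) + y * I)‖ ≤ wickDecayConst * R ^ (-(13 / 8 : ℝ)) := by
      intro y _
      have hre : R ≤ ‖((s * R : ℝ) : ℂ) + (y : ℂ) * I‖ := by
        have h := Complex.abs_re_le_norm (((s * R : ℝ) : ℂ) + (y : ℂ) * I)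
        have : |s * R| = R := by
          rcases hs with h1 | h1 <;> simp [h1, abs_of_pos hR0]
        simpa [this] using h
      have h4 : 4 ≤ ‖((s * R : ℝ) : ℂ) + (y : ℂ) * I‖ := hR.trans hre
      calc ‖wickH ((s * R : ℝ) + y * I)‖ ≤ wickDecayConst * ‖((s * R : ℝ) : ℂ) + (y : ℂ) * I‖ ^ (-(13 / 8 : ℝ)) :=
            norm_wickH_le_rpow_of_four_le h4
        _ ≤ wickDecayConst * R ^ (-(13 / 8 : ℝ)) :=
            mul_le_mul_of_nonneg_left (Real.rpow_le_rpow_of_nonpos hR0 hre (by norm_num))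
              wickDecayConst_nonneg
    calc ‖∫ y : ℝ in (-c)..(-ε), wickH ((s * R : ℝ) + y * I)‖
          ≤ wickDecayConst * R ^ (-(13 / 8 : ℝ)) * |(-ε) - (-c)| :=
            intervalIntegral.norm_integral_le_of_norm_le_const hpt
      _ = wickDecayConst * |(-ε) - (-c)| * R ^ (-(13 / 8 : ℝ)) := by ring

/-- **Depth independence**: for `0 < ε ≤ c`, `∫_ℝ H(x − ci) dx = ∫_ℝ H(x − εi) dx`. [folklore] -/
theorem integral_wickH_horizontal_eq {ε c : ℝ} (hε : 0 < ε) (hεc : ε ≤ c) :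
    ∫ x : ℝ, wickH ((x : ℂ) - (c : ℂ) * I) = ∫ x : ℝ, wickH ((x : ℂ) - (ε : ℂ) * I) := by
  have hc : 0 < c := lt_of_lt_of_le hε hεc
  -- normalize the integrands of the rectangle identity
  have e1 : ∀ (d : ℝ) (x : ℝ), wickH ((x : ℂ) + ((-d : ℝ) : ℂ) * I) = wickH ((x : ℂ) - (d : ℂ) * I) := by
    intro d x; congr 1; push_cast; ring
  have hL : Tendsto (fun R : ℝ => (∫ x : ℝ in -R..R, wickH (x + (-c : ℝ) * I)) -
      ∫ x : ℝ in -R..R, wickH (x + (-ε : ℝ) * I)) atTop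
      (𝓝 ((∫ x : ℝ, wickH ((x : ℂ) - (c : ℂ) * I)) - ∫ x : ℝ, wickH ((x : ℂ) - (ε : ℂ) * I))) := by
    simp_rw [e1]
    exact (intervalIntegral_tendsto_integral (integrable_wickH_horizontal hc) tendsto_neg_atTop_atBot
      tendsto_id).sub (intervalIntegral_tendsto_integral (integrable_wickH_horizontal hε)
        tendsto_neg_atTop_atBot tendsto_id)
  have hR : Tendsto (fun R : ℝ => (∫ x : ℝ in -R..R, wickH (x + (-c : ℝ) * I)) -
      ∫ x : ℝ in -R..R, wickH (x + (-ε : ℝ) * I)) atTop (𝓝 0) := by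
    have hside₁ := tendsto_wickH_side ε c 1 (Or.inl rfl)
    have hside₂ := tendsto_wickH_side ε c (-1) (Or.inr rfl)
    have heq : ∀ R : ℝ, (∫ x : ℝ in -R..R, wickH (x + (-c : ℝ) * I)) -
        (∫ x : ℝ in -R..R, wickH (x + (-ε : ℝ) * I)) =
        I • (∫ y : ℝ in (-c)..(-ε), wickH (((-1) * R : ℝ) + y * I)) -
        I • (∫ y : ℝ in (-c)..(-ε), wickH (((1 : ℝ) * R : ℝ) + y * I)) := by
      intro R
      have h := wickH_boundary_rect hε hεc R
      rw [show ((1 : ℝ) * R) = R by ring, show ((-1 : ℝ) * R) = -R by ring]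
      linear_combination h
    simp_rw [heq]
    have := (hside₂.const_smul I).sub (hside₁.const_smul I)
    simpa using this
  have := tendsto_nhds_unique hL hR
  exact sub_eq_zero.mp this

/-- A point at depth `c ≥ 4` is far: `(1 + |x|)/√2 ≤ ‖x − ci‖`. [folklore] -/
theorem one_add_abs_le_norm {x c : ℝ} (hc : 4 ≤ c) :
    (1 + |x|) / Real.sqrt 2 ≤ ‖(x : ℂ) - (c : ℂ) * I‖ := by
  have hn : ‖(x : ℂ) - (c : ℂ) * I‖ ^ 2 = x ^ 2 + c ^ 2 := by
    rw [Complex.sq_norm, Complex.normSq_apply]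
    simp
    ring
  have h1 : ((1 + |x|) / Real.sqrt 2) ^ 2 ≤ ‖(x : ℂ) - (c : ℂ) * I‖ ^ 2 := by
    rw [hn, div_pow, Real.sq_sqrt (by norm_num : (0 : ℝ) ≤ 2)]
    have hxx : |x| ^ 2 = x ^ 2 := sq_abs x
    have hc2 : 16 ≤ c ^ 2 := by nlinarith
    nlinarith [sq_nonneg (|x| - 1), abs_nonneg x]
  exact (pow_le_pow_iff_left₀ (by positivity) (norm_nonneg _) two_ne_zero).mp h1

/-- **The far horizontal line vanishes**: `∫_ℝ H(x − ci) dx → 0` as `c → ∞` (dominated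
convergence with the envelope `C(1+|x|)^{−13/8}`, valid for `c ≥ 4`). [folklore] -/
theorem tendsto_integral_wickH_horizontal_atTop :
    Tendsto (fun c : ℝ => ∫ x : ℝ, wickH ((x : ℂ) - (c : ℂ) * I)) atTop (𝓝 0) := by
  have hkey : ∀ c : ℝ, 4 ≤ c → ∀ x : ℝ,
      ‖wickH ((x : ℂ) - (c : ℂ) * I)‖ ≤ wickDecayConst * ‖(x : ℂ) - (c : ℂ) * I‖ ^ (-(13 / 8 : ℝ)) := by
    intro c hc x
    apply norm_wickH_le_rpow_of_four_le
    calc (4 : ℝ) ≤ |c| := by rw [abs_of_nonneg (by linarith)]; exact hc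
      _ ≤ _ := abs_le_norm_sub_mul_I' x c
  have hlim : Tendsto (fun c : ℝ => ∫ x : ℝ, wickH ((x : ℂ) - (c : ℂ) * I)) atTop (𝓝 (∫ _ : ℝ, (0 : ℂ))) := by
    refine tendsto_integral_filter_of_dominated_convergence
      (fun x => wickDecayConst * (Real.sqrt 2) ^ (13 / 8 : ℝ) * (1 + ‖x‖) ^ (-(13 / 8 : ℝ))) ?_ ?_
      ((integrable_one_add_abs_rpow.const_mul _)) ?_
    · filter_upwards [eventually_ge_atTop (4 : ℝ)] with c hc
      exact (continuous_wickH_horizontal (by linarith)).aestronglyMeasurable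
    · filter_upwards [eventually_ge_atTop (4 : ℝ)] with c hc
      refine Eventually.of_forall fun x => ?_
      have h1x : 0 < 1 + |x| := by positivity
      have hfar := one_add_abs_le_norm (x := x) hc
      have hpos : 0 < (1 + |x|) / Real.sqrt 2 := by positivity
      rw [Real.norm_eq_abs]
      calc ‖wickH ((x : ℂ) - (c : ℂ) * I)‖ ≤ wickDecayConst * ‖(x : ℂ) - (c : ℂ) * I‖ ^ (-(13 / 8 : ℝ)) :=
            hkey c hc x
        _ ≤ wickDecayConst * ((1 + |x|) / Real.sqrt 2) ^ (-(13 / 8 : ℝ)) :=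
            mul_le_mul_of_nonneg_left (Real.rpow_le_rpow_of_nonpos hpos hfar (by norm_num))
              wickDecayConst_nonneg
        _ = wickDecayConst * (Real.sqrt 2) ^ (13 / 8 : ℝ) * (1 + |x|) ^ (-(13 / 8 : ℝ)) := by
            rw [div_eq_mul_inv, Real.mul_rpow h1x.le (by positivity), Real.inv_rpow (by positivity),
              ← Real.rpow_neg (by positivity), neg_neg]
            ring
    · refine Eventually.of_forall fun x => ?_
      refine squeeze_zero_norm' ?_ ((tendsto_rpow_neg_atTop (by norm_num : (0 : ℝ) < 13 / 8)).const_mul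
        wickDecayConst |>.congr' (Eventually.of_forall fun c => rfl) |> fun h => by simpa using h)
      filter_upwards [eventually_ge_atTop (4 : ℝ)] with c hc
      have hc0 : 0 < c := by linarith
      calc ‖wickH ((x : ℂ) - (c : ℂ) * I)‖ ≤ wickDecayConst * ‖(x : ℂ) - (c : ℂ) * I‖ ^ (-(13 / 8 : ℝ)) :=
            hkey c hc x
        _ ≤ wickDecayConst * c ^ (-(13 / 8 : ℝ)) := by
            apply mul_le_mul_of_nonneg_left _ wickDecayConst_nonneg
            apply Real.rpow_le_rpow_of_nonpos hc0 _ (by norm_num)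
            calc c = |c| := (abs_of_pos hc0).symm
              _ ≤ _ := abs_le_norm_sub_mul_I' x c
  simpa using hlim

/-- **The Wick rotation, analytic core**: for every `ε > 0`, `∫_ℝ H(x − εi) dx = 0`.
[cite: Zhou2013, Cor. 4.2 (arXiv p. 18)] -/
theorem integral_wickH_horizontal_eq_zero {ε : ℝ} (hε : 0 < ε) :
    ∫ x : ℝ, wickH ((x : ℂ) - (ε : ℂ) * I) = 0 := by
  have hconst : (fun c : ℝ => ∫ x : ℝ, wickH ((x : ℂ) - (c : ℂ) * I)) =ᶠ[atTop]
      fun _ => ∫ x : ℝ, wickH ((x : ℂ) - (ε : ℂ) * I) := by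
    filter_upwards [eventually_ge_atTop ε] with c hc
    exact integral_wickH_horizontal_eq hε hc
  have h := tendsto_integral_wickH_horizontal_atTop.congr' hconst
  exact tendsto_nhds_unique tendsto_const_nhds h

/-! ### The limit `ε → 0⁺`: a dominating function -/

/-- `x ↦ |x|^r` is interval integrable on every interval for `r > −1`. [folklore] -/
theorem intervalIntegrable_abs_rpow {r : ℝ} (hr : -1 < r) (α β : ℝ) :
    IntervalIntegrable (fun x : ℝ => |x| ^ r) volume α β := by
  have h0 : ∀ γ : ℝ, IntervalIntegrable (fun x : ℝ => |x| ^ r) volume 0 γ := by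
    intro γ
    rcases le_or_gt 0 γ with hγ | hγ
    · refine (intervalIntegral.intervalIntegrable_rpow' hr (a := 0) (b := γ)).congr fun x hx => ?_
      rw [uIoc_of_le hγ] at hx
      simp only [abs_of_pos hx.1]
    · have h0' : IntervalIntegrable (fun x : ℝ => x ^ r) volume 0 (-γ) :=
        intervalIntegral.intervalIntegrable_rpow' hr
      have h := (IntervalIntegrable.iff_comp_neg (f := fun x : ℝ => x ^ r) (a := 0) (b := -γ)).mp h0'
      rw [neg_zero, neg_neg] at h
      refine h.congr fun x hx => ?_
      rw [uIoc_of_ge hγ.le] at hx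
      simp only [abs_of_nonpos hx.2]
  exact (h0 α).symm.trans (h0 β)

/-- `x ↦ |x − a|^r` is interval integrable on every interval for `r > −1`. [folklore] -/
theorem intervalIntegrable_abs_sub_rpow {r : ℝ} (hr : -1 < r) (a α β : ℝ) :
    IntervalIntegrable (fun x : ℝ => |x - a| ^ r) volume α β := by
  have h := (intervalIntegrable_abs_rpow hr (α - a) (β - a)).comp_sub_right a
  simpa using h

/-- `x ↦ |x − a|^{−p}` is integrable on `[l, u]` for `p < 1`. [folklore] -/
theorem integrableOn_abs_sub_rpow_neg {p : ℝ} (hp : p < 1) (a l u : ℝ) (hlu : l ≤ u) :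
    IntegrableOn (fun x : ℝ => |x - a| ^ (-p)) (Icc l u) := by
  have h := intervalIntegrable_abs_sub_rpow (r := -p) (by linarith) a l u
  rwa [intervalIntegrable_iff_integrableOn_Icc_of_le hlu] at h

/-- The middle-range constant `C_B = 8·5^{1/8}` (`≥ 8 ≥ π/2`). [folklore] -/
def wickMidConst : ℝ := 8 * (5 : ℝ) ^ (1 / 8 : ℝ)

/-- `8 ≤ C_B`. [folklore] -/
theorem eight_le_wickMidConst : 8 ≤ wickMidConst := by
  unfold wickMidConst
  have : (1 : ℝ) ≤ (5 : ℝ) ^ (1 / 8 : ℝ) := Real.one_le_rpow (by norm_num) (by norm_num)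
  linarith

/-- **Middle-range bound for `Kc` on vertical approaches**: for `y ∈ [−4, 5]`, `y ≠ 1` and every
real `ε`, `‖Kc(y − εi)‖ ≤ C_B(|y − 1|^{−1/8} + 1)`. [folklore] -/
theorem norm_Kc_vertical_le_mid {y ε : ℝ} (hy : y ∈ Icc (-4 : ℝ) 5) (hy1 : y ≠ 1) :
    ‖Kc ((y : ℂ) - (ε : ℂ) * I)‖ ≤ wickMidConst * (|y - 1| ^ (-(1 / 8 : ℝ)) + 1) := by
  have hre : ((y : ℂ) - (ε : ℂ) * I).re = y := by simp
  have hC := eight_le_wickMidConst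
  have hC0 : 0 ≤ wickMidConst := by linarith
  have hpow0 : 0 ≤ |y - 1| ^ (-(1 / 8 : ℝ)) := Real.rpow_nonneg (abs_nonneg _) _
  rcases lt_trichotomy y 1 with h1 | h1 | h1
  · rcases le_or_gt y 0 with h0 | h0
    · -- y ≤ 0
      have h := norm_Kc_le_of_re_nonpos (m := (y : ℂ) - (ε : ℂ) * I) (by rw [hre]; exact h0)
      calc ‖Kc ((y : ℂ) - (ε : ℂ) * I)‖ ≤ π / 2 := h
        _ ≤ 8 := by linarith [Real.pi_le_four]
        _ ≤ wickMidConst * (|y - 1| ^ (-(1 / 8 : ℝ)) + 1) := by nlinarith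
    · -- 0 < y < 1
      have h := norm_Kc_le_of_re_lt_one (m := (y : ℂ) - (ε : ℂ) * I) (by rw [hre]; exact h1)
      rw [hre] at h
      have hK := ellipticK_le_rpow (u := y) (θ := 1 / 4) h0.le h1 (by norm_num) (by norm_num)
      have e : (1 - y) ^ (-((1 / 4 : ℝ) / 2)) = |y - 1| ^ (-(1 / 8 : ℝ)) := by
        rw [abs_sub_comm, abs_of_pos (by linarith)]; norm_num
      rw [e, show (2 : ℝ) / (1 / 4) = 8 by norm_num] at hK
      calc ‖Kc ((y : ℂ) - (ε : ℂ) * I)‖ ≤ 8 * |y - 1| ^ (-(1 / 8 : ℝ)) := h.trans hK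
        _ ≤ wickMidConst * (|y - 1| ^ (-(1 / 8 : ℝ)) + 1) := by nlinarith
  · exact absurd h1 hy1
  · -- 1 < y ≤ 5
    have hy0 : 0 < y := by linarith
    have hy5 : y ≤ 5 := hy.2
    have h := norm_Kc_le_of_one_lt_re (m := (y : ℂ) - (ε : ℂ) * I) (by rw [hre]; exact h1)
    rw [hre] at h
    have hlt : 1 / y < 1 := (div_lt_one hy0).mpr h1
    have hpos : 0 < 1 / y := by positivity
    have hK1 := ellipticK_le_rpow (u := 1 / y) (θ := 1 / 4) hpos.le hlt (by norm_num) (by norm_num)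
    have hK2 := ellipticK_le_rpow (u := 1 - 1 / y) (θ := 1 / 4) (by linarith) (by linarith)
      (by norm_num) (by norm_num)
    rw [show (2 : ℝ) / (1 / 4) = 8 by norm_num] at hK1 hK2
    -- `(1 - 1/y)^{-1/8} = y^{1/8} (y-1)^{-1/8} ≤ 5^{1/8} |y-1|^{-1/8}`
    have e1 : (1 - 1 / y) ^ (-((1 / 4 : ℝ) / 2)) = y ^ (1 / 8 : ℝ) * |y - 1| ^ (-(1 / 8 : ℝ)) := by
      rw [abs_of_pos (by linarith), show 1 - 1 / y = (y - 1) / y by field_simp,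
        div_eq_mul_inv, Real.mul_rpow (by linarith) (by positivity), Real.inv_rpow hy0.le,
        ← Real.rpow_neg hy0.le]
      norm_num
      ring
    have e2 : (1 - (1 - 1 / y)) ^ (-((1 / 4 : ℝ) / 2)) = y ^ (1 / 8 : ℝ) := by
      rw [sub_sub_cancel, one_div y, Real.inv_rpow hy0.le, ← Real.rpow_neg hy0.le]
      norm_num
    rw [e1] at hK1
    rw [e2] at hK2
    have hy8 : y ^ (1 / 8 : ℝ) ≤ (5 : ℝ) ^ (1 / 8 : ℝ) := Real.rpow_le_rpow hy0.le hy5 (by norm_num)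
    have hsq : 1 / Real.sqrt y ≤ 1 := by
      rw [div_le_one (Real.sqrt_pos.mpr hy0), show (1 : ℝ) = Real.sqrt 1 from Real.sqrt_one.symm]
      exact Real.sqrt_le_sqrt h1.le
    have hsum0 : 0 ≤ ellipticK (1 / y) + ellipticK (1 - 1 / y) :=
      add_nonneg (ellipticK_nonneg _) (ellipticK_nonneg _)
    calc ‖Kc ((y : ℂ) - (ε : ℂ) * I)‖ ≤ 1 / Real.sqrt y * (ellipticK (1 / y) + ellipticK (1 - 1 / y)) := h
      _ ≤ 1 * (ellipticK (1 / y) + ellipticK (1 - 1 / y)) := mul_le_mul_of_nonneg_right hsq hsum0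
      _ ≤ 8 * (y ^ (1 / 8 : ℝ) * |y - 1| ^ (-(1 / 8 : ℝ))) + 8 * y ^ (1 / 8 : ℝ) := by
          rw [one_mul]; exact add_le_add hK1 hK2
      _ ≤ 8 * ((5 : ℝ) ^ (1 / 8 : ℝ) * |y - 1| ^ (-(1 / 8 : ℝ))) + 8 * (5 : ℝ) ^ (1 / 8 : ℝ) := by
          apply add_le_add _ (by nlinarith)
          exact mul_le_mul_of_nonneg_left (mul_le_mul_of_nonneg_right hy8 hpow0) (by norm_num)
      _ = wickMidConst * (|y - 1| ^ (-(1 / 8 : ℝ)) + 1) := by unfold wickMidConst; ring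

/-- The dominating function of the limit `ε → 0⁺`: singular part on `[−4, 5]` plus the tail
envelope. [folklore] -/
def wickDom (x : ℝ) : ℝ :=
  Set.indicator (Icc (-4 : ℝ) 5)
      (fun x => wickMidConst ^ 3 * (|x - 1| ^ (-(1 / 8 : ℝ)) + |x| ^ (-(1 / 8 : ℝ)) + 2) ^ 3 *
        |x - 1| ^ (-(1 / 2 : ℝ))) x +
    wickDecayConst * (4 / 5 : ℝ) ^ (-(13 / 8 : ℝ)) * (1 + ‖x‖) ^ (-(13 / 8 : ℝ))

/-- Elementary: `a³b⁴ ≤ a⁷ + b⁷` for `a, b ≥ 0`. [folklore] -/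
theorem cube_mul_fourth_le {a b : ℝ} (ha : 0 ≤ a) (hb : 0 ≤ b) : a ^ 3 * b ^ 4 ≤ a ^ 7 + b ^ 7 := by
  rcases le_or_gt a b with h | h
  · have : a ^ 3 ≤ b ^ 3 := pow_le_pow_left₀ ha h 3
    nlinarith [pow_nonneg hb 4, pow_nonneg ha 7]
  · have : b ^ 4 ≤ a ^ 4 := pow_le_pow_left₀ hb h.le 4
    nlinarith [pow_nonneg ha 3, pow_nonneg hb 7]

/-- **The singular part of the dominating function is integrable on `[−4, 5]`.** [folklore] -/
theorem integrableOn_wickDom_mid :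
    IntegrableOn (fun x : ℝ => wickMidConst ^ 3 * (|x - 1| ^ (-(1 / 8 : ℝ)) + |x| ^ (-(1 / 8 : ℝ)) + 2) ^ 3 *
      |x - 1| ^ (-(1 / 2 : ℝ))) (Icc (-4 : ℝ) 5) := by
  -- majorant: 9 C_B³ (2|x-1|^{-7/8} + |x|^{-7/8} + 8|x-1|^{-1/2})
  have hI1 := integrableOn_abs_sub_rpow_neg (p := 7 / 8) (by norm_num) 1 (-4 : ℝ) 5 (by norm_num)
  have hI0 := integrableOn_abs_sub_rpow_neg (p := 7 / 8) (by norm_num) 0 (-4 : ℝ) 5 (by norm_num)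
  have hI2 := integrableOn_abs_sub_rpow_neg (p := 1 / 2) (by norm_num) 1 (-4 : ℝ) 5 (by norm_num)
  have hC0 : 0 ≤ wickMidConst := by linarith [eight_le_wickMidConst]
  have hmaj : IntegrableOn (fun x : ℝ => 9 * wickMidConst ^ 3 *
      (2 * |x - 1| ^ (-(7 / 8 : ℝ)) + |x - 0| ^ (-(7 / 8 : ℝ)) + 8 * |x - 1| ^ (-(1 / 2 : ℝ)))) (Icc (-4 : ℝ) 5) :=
    (((hI1.const_mul 2).add hI0).add (hI2.const_mul 8)).const_mul _
  refine hmaj.mono' ?_ ?_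
  · refine (Measurable.aestronglyMeasurable ?_)
    apply Measurable.mul (Measurable.const_mul (Measurable.pow_const ?_ 3) _) ?_
    · exact ((((measurable_id.sub_const 1).abs.pow_const _).add
        (measurable_id.abs.pow_const _)).add_const 2)
    · exact (measurable_id.sub_const 1).abs.pow_const _
  · refine (ae_restrict_iff' measurableSet_Icc).mpr ?_
    -- exclude the null set {0, 1}
    have hnull : ∀ᵐ x : ℝ, x ≠ 0 ∧ x ≠ 1 := by
      have h : volume ({0, 1} : Set ℝ) = 0 := (Set.toFinite _).measure_zero _
      rw [ae_iff]
      refine measure_mono_null (fun x hx => ?_) h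
      simp only [Set.mem_setOf_eq, not_and_or, not_not] at hx
      rcases hx with hx | hx <;> simp [hx]
    filter_upwards [hnull] with x hx _
    obtain ⟨hx0, hx1⟩ := hx
    set a := |x| ^ (-(1 / 8 : ℝ)) with ha
    set b := |x - 1| ^ (-(1 / 8 : ℝ)) with hb
    have hxpos : 0 < |x| := abs_pos.mpr hx0
    have hx1pos : 0 < |x - 1| := abs_pos.mpr (sub_ne_zero.mpr hx1)
    have ha0 : 0 < a := Real.rpow_pos_of_pos hxpos _
    have hb0 : 0 < b := Real.rpow_pos_of_pos hx1pos _
    have ha7 : a ^ 7 = |x| ^ (-(7 / 8 : ℝ)) := by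
      rw [ha, ← Real.rpow_natCast, ← Real.rpow_mul hxpos.le]; norm_num
    have hb7 : b ^ 7 = |x - 1| ^ (-(7 / 8 : ℝ)) := by
      rw [hb, ← Real.rpow_natCast, ← Real.rpow_mul hx1pos.le]; norm_num
    have hb4 : b ^ 4 = |x - 1| ^ (-(1 / 2 : ℝ)) := by
      rw [hb, ← Real.rpow_natCast, ← Real.rpow_mul hx1pos.le]; norm_num
    have hb3w : b ^ 3 * |x - 1| ^ (-(1 / 2 : ℝ)) = b ^ 7 := by rw [← hb4]; ring
    rw [Real.norm_eq_abs, abs_of_nonneg (by positivity), sub_zero]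
    -- (b + a + 2)^3 ≤ 9 (b^3 + a^3 + 8)  (power-mean inequality)
    have h3 : (b + a + 2) ^ 3 ≤ 9 * (b ^ 3 + a ^ 3 + 2 ^ 3) := by
      nlinarith [sq_nonneg (b - a), sq_nonneg (a - 2), sq_nonneg (b - 2), mul_nonneg hb0.le ha0.le,
        mul_nonneg (mul_nonneg hb0.le ha0.le) (by norm_num : (0 : ℝ) ≤ 2), ha0.le, hb0.le]
    have hcross : a ^ 3 * |x - 1| ^ (-(1 / 2 : ℝ)) ≤ |x| ^ (-(7 / 8 : ℝ)) + |x - 1| ^ (-(7 / 8 : ℝ)) := by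
      rw [← hb4, ← ha7, ← hb7]; exact cube_mul_fourth_le ha0.le hb0.le
    have hw0 : 0 ≤ |x - 1| ^ (-(1 / 2 : ℝ)) := Real.rpow_nonneg (abs_nonneg _) _
    calc wickMidConst ^ 3 * (b + a + 2) ^ 3 * |x - 1| ^ (-(1 / 2 : ℝ))
          ≤ wickMidConst ^ 3 * (9 * (b ^ 3 + a ^ 3 + 2 ^ 3)) * |x - 1| ^ (-(1 / 2 : ℝ)) := by
            apply mul_le_mul_of_nonneg_right _ hw0
            exact mul_le_mul_of_nonneg_left h3 (by positivity)
      _ = 9 * wickMidConst ^ 3 * (b ^ 3 * |x - 1| ^ (-(1 / 2 : ℝ)) + a ^ 3 * |x - 1| ^ (-(1 / 2 : ℝ)) +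
            8 * |x - 1| ^ (-(1 / 2 : ℝ))) := by ring
      _ ≤ 9 * wickMidConst ^ 3 * (|x - 1| ^ (-(7 / 8 : ℝ)) + (|x| ^ (-(7 / 8 : ℝ)) + |x - 1| ^ (-(7 / 8 : ℝ))) +
            8 * |x - 1| ^ (-(1 / 2 : ℝ))) := by
            rw [hb3w, hb7]
            apply mul_le_mul_of_nonneg_left _ (by positivity)
            linarith
      _ = 9 * wickMidConst ^ 3 * (2 * |x - 1| ^ (-(7 / 8 : ℝ)) + |x| ^ (-(7 / 8 : ℝ)) + 8 * |x - 1| ^ (-(1 / 2 : ℝ))) := by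
            ring

/-- **The dominating function is integrable on `ℝ`.** [folklore] -/
theorem integrable_wickDom : Integrable wickDom := by
  unfold wickDom
  exact (integrableOn_wickDom_mid.integrable_indicator measurableSet_Icc).add
    (integrable_one_add_abs_rpow.const_mul _)

/-- **Domination**: for every real `ε` and `x ∉ {0, 1}`, `‖H(x − εi)‖ ≤ wickDom x`. [folklore] -/
theorem norm_wickH_vertical_le_wickDom {x : ℝ} (ε : ℝ) (hx0 : x ≠ 0) (hx1 : x ≠ 1) :
    ‖wickH ((x : ℂ) - (ε : ℂ) * I)‖ ≤ wickDom x := by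
  have htail0 : 0 ≤ wickDecayConst * (4 / 5 : ℝ) ^ (-(13 / 8 : ℝ)) * (1 + ‖x‖) ^ (-(13 / 8 : ℝ)) := by
    have := wickDecayConst_nonneg; positivity
  by_cases hx : x ∈ Icc (-4 : ℝ) 5
  · -- middle range: singular bound
    rw [wickDom, Set.indicator_of_mem hx]
    have hC := eight_le_wickMidConst
    have hC0 : 0 ≤ wickMidConst := by linarith
    have h1x : (1 - x : ℝ) ∈ Icc (-4 : ℝ) 5 := ⟨by linarith [hx.2], by linarith [hx.1]⟩
    have hK1 := norm_Kc_vertical_le_mid (ε := ε) hx hx1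
    have hK2 := norm_Kc_vertical_le_mid (ε := ε) h1x (by intro h; apply hx0; linarith)
    rw [show |(1 - x : ℝ) - 1| = |x| by rw [show (1 - x : ℝ) - 1 = -x by ring, abs_neg] ] at hK2
    have heq : (1 : ℂ) - (starRingEnd ℂ) ((x : ℂ) - (ε : ℂ) * I) = ((1 - x : ℝ) : ℂ) - (ε : ℂ) * I := by
      simp only [map_sub, Complex.conj_ofReal, map_mul, Complex.conj_I]; push_cast; ring
    have hA : ‖wickA ((x : ℂ) - (ε : ℂ) * I)‖ ≤
        wickMidConst * (|x - 1| ^ (-(1 / 8 : ℝ)) + |x| ^ (-(1 / 8 : ℝ)) + 2) := by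
      unfold wickA
      rw [heq]
      calc ‖Kc ((x : ℂ) - (ε : ℂ) * I) + I * (starRingEnd ℂ) (Kc (((1 - x : ℝ) : ℂ) - (ε : ℂ) * I))‖
            ≤ ‖Kc ((x : ℂ) - (ε : ℂ) * I)‖ + ‖I * (starRingEnd ℂ) (Kc (((1 - x : ℝ) : ℂ) - (ε : ℂ) * I))‖ :=
              norm_add_le _ _
        _ = ‖Kc ((x : ℂ) - (ε : ℂ) * I)‖ + ‖Kc (((1 - x : ℝ) : ℂ) - (ε : ℂ) * I)‖ := by
              rw [norm_mul, Complex.norm_I, one_mul, Complex.norm_conj]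
        _ ≤ wickMidConst * (|x - 1| ^ (-(1 / 8 : ℝ)) + 1) + wickMidConst * (|x| ^ (-(1 / 8 : ℝ)) + 1) :=
              add_le_add hK1 hK2
        _ = wickMidConst * (|x - 1| ^ (-(1 / 8 : ℝ)) + |x| ^ (-(1 / 8 : ℝ)) + 2) := by ring
    have hA0 : 0 ≤ ‖wickA ((x : ℂ) - (ε : ℂ) * I)‖ := norm_nonneg _
    have hw : ‖(1 - ((x : ℂ) - (ε : ℂ) * I)) ^ (-(1 / 2 : ℂ))‖ ≤ |x - 1| ^ (-(1 / 2 : ℝ)) := by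
      rw [norm_cpow_neg_half]
      apply Real.rpow_le_rpow_of_nonpos (abs_pos.mpr (sub_ne_zero.mpr hx1)) _ (by norm_num)
      have h := Complex.abs_re_le_norm (1 - ((x : ℂ) - (ε : ℂ) * I))
      rw [abs_sub_comm]
      simpa using h
    have hs0 : 0 ≤ |x - 1| ^ (-(1 / 8 : ℝ)) + |x| ^ (-(1 / 8 : ℝ)) + 2 := by positivity
    calc ‖wickH ((x : ℂ) - (ε : ℂ) * I)‖
          = ‖wickA ((x : ℂ) - (ε : ℂ) * I)‖ ^ 3 * ‖(1 - ((x : ℂ) - (ε : ℂ) * I)) ^ (-(1 / 2 : ℂ))‖ := by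
            rw [wickH, norm_mul, norm_pow]
      _ ≤ (wickMidConst * (|x - 1| ^ (-(1 / 8 : ℝ)) + |x| ^ (-(1 / 8 : ℝ)) + 2)) ^ 3 * |x - 1| ^ (-(1 / 2 : ℝ)) :=
            mul_le_mul (pow_le_pow_left₀ hA0 hA 3) hw (norm_nonneg _) (by positivity)
      _ = wickMidConst ^ 3 * (|x - 1| ^ (-(1 / 8 : ℝ)) + |x| ^ (-(1 / 8 : ℝ)) + 2) ^ 3 * |x - 1| ^ (-(1 / 2 : ℝ)) := by
            ring
      _ ≤ _ := le_add_of_nonneg_right htail0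
  · -- tail: decay bound
    rw [wickDom, Set.indicator_of_notMem hx, zero_add]
    have hx4 : 4 < |x| := by
      simp only [Set.mem_Icc, not_and_or, not_le] at hx
      rcases hx with h | h
      · rw [abs_of_neg (by linarith)]; linarith
      · rw [abs_of_pos (by linarith)]; linarith
    have h1x : 0 < 1 + |x| := by positivity
    have hnorm : 4 ≤ ‖(x : ℂ) - (ε : ℂ) * I‖ := hx4.le.trans (abs_le_norm_sub_mul_I x ε)
    have hb := norm_wickH_le_rpow_of_four_le hnorm
    have hxpos : 0 < |x| := by linarith
    have h2 : ‖(x : ℂ) - (ε : ℂ) * I‖ ^ (-(13 / 8 : ℝ)) ≤ |x| ^ (-(13 / 8 : ℝ)) :=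
      Real.rpow_le_rpow_of_nonpos hxpos (abs_le_norm_sub_mul_I x ε) (by norm_num)
    have h3 : |x| ^ (-(13 / 8 : ℝ)) ≤ (4 / 5 : ℝ) ^ (-(13 / 8 : ℝ)) * (1 + |x|) ^ (-(13 / 8 : ℝ)) := by
      have h45 : (4 / 5 : ℝ) * (1 + |x|) ≤ |x| := by linarith
      calc |x| ^ (-(13 / 8 : ℝ)) ≤ ((4 / 5 : ℝ) * (1 + |x|)) ^ (-(13 / 8 : ℝ)) :=
            Real.rpow_le_rpow_of_nonpos (by positivity) h45 (by norm_num)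
        _ = (4 / 5 : ℝ) ^ (-(13 / 8 : ℝ)) * (1 + |x|) ^ (-(13 / 8 : ℝ)) :=
            Real.mul_rpow (by norm_num) h1x.le
    rw [Real.norm_eq_abs]
    calc ‖wickH ((x : ℂ) - (ε : ℂ) * I)‖ ≤ wickDecayConst * ‖(x : ℂ) - (ε : ℂ) * I‖ ^ (-(13 / 8 : ℝ)) := hb
      _ ≤ wickDecayConst * ((4 / 5 : ℝ) ^ (-(13 / 8 : ℝ)) * (1 + |x|) ^ (-(13 / 8 : ℝ))) :=
          mul_le_mul_of_nonneg_left (h2.trans h3) wickDecayConst_nonneg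
      _ = wickDecayConst * (4 / 5 : ℝ) ^ (-(13 / 8 : ℝ)) * (1 + |x|) ^ (-(13 / 8 : ℝ)) := by ring

/-! ### The limit `ε → 0⁺` and the real-variable identity -/

/-- The null set `{0, 1}`: a.e. `x ≠ 0 ∧ x ≠ 1`. [folklore] -/
theorem ae_ne_zero_and_ne_one : ∀ᵐ x : ℝ, x ≠ 0 ∧ x ≠ 1 := by
  have h : volume ({0, 1} : Set ℝ) = 0 := (Set.toFinite _).measure_zero _
  rw [ae_iff]
  refine measure_mono_null (fun x hx => ?_) h
  simp only [Set.mem_setOf_eq, not_and_or, not_not] at hx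
  rcases hx with hx | hx <;> simp [hx]

/-- **The boundary integral vanishes**: `∫_ℝ H₀(x) dx = 0`, where `H₀` is the vertical limit of `H`
(dominated convergence with `wickDom` as `ε → 0⁺`, and `∫_ℝ H(x − εi) dx = 0`). [folklore] -/
theorem integral_wickH₀_eq_zero : ∫ x : ℝ, wickH₀ x = 0 := by
  have hlim : Tendsto (fun ε : ℝ => ∫ x : ℝ, wickH ((x : ℂ) - (ε : ℂ) * I)) (𝓝[>] 0)
      (𝓝 (∫ x : ℝ, wickH₀ x)) := by
    refine tendsto_integral_filter_of_dominated_convergence wickDom ?_ ?_ integrable_wickDom ?_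
    · filter_upwards [self_mem_nhdsWithin] with ε hε
      exact (continuous_wickH_horizontal hε).aestronglyMeasurable
    · refine Eventually.of_forall fun ε => ?_
      filter_upwards [ae_ne_zero_and_ne_one] with x hx
      exact norm_wickH_vertical_le_wickDom ε hx.1 hx.2
    · filter_upwards [ae_ne_zero_and_ne_one] with x hx
      exact tendsto_wickH_vertical hx.1 hx.2
  have hzero : (fun ε : ℝ => ∫ x : ℝ, wickH ((x : ℂ) - (ε : ℂ) * I)) =ᶠ[𝓝[>] 0] fun _ => (0 : ℂ) := by
    filter_upwards [self_mem_nhdsWithin] with ε hε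
    exact integral_wickH_horizontal_eq_zero hε
  exact tendsto_nhds_unique (hlim.congr' hzero) tendsto_const_nhds

/-- The boundary function is integrable on `ℝ` (limit of continuous functions, dominated by
`wickDom`). [folklore] -/
theorem integrable_wickH₀ : Integrable wickH₀ := by
  -- a.e.-strong measurability: `H₀` is an a.e. limit of continuous functions
  have hmeas : AEStronglyMeasurable wickH₀ volume := by
    refine aestronglyMeasurable_of_tendsto_ae (μ := volume) (𝓝[>] (0 : ℝ))
      (f := fun (ε : ℝ) (x : ℝ) => if 0 < ε then wickH ((x : ℂ) - (ε : ℂ) * I) else 0)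
      (g := wickH₀) (fun ε => ?_) ?_
    · by_cases hε : 0 < ε
      · simp only [hε, if_true]; exact (continuous_wickH_horizontal hε).aestronglyMeasurable
      · simp only [hε, if_false]; exact aestronglyMeasurable_const
    · filter_upwards [ae_ne_zero_and_ne_one] with x hx
      refine (tendsto_wickH_vertical hx.1 hx.2).congr' ?_
      filter_upwards [self_mem_nhdsWithin] with ε hε
      simp only [Set.mem_Ioi] at hε
      simp [hε]
  refine integrable_wickDom.mono' hmeas ?_
  filter_upwards [ae_ne_zero_and_ne_one] with x hx
  refine le_of_tendsto ((continuous_norm.tendsto _).comp (tendsto_wickH_vertical hx.1 hx.2)) ?_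
  filter_upwards [self_mem_nhdsWithin] with ε _
  exact norm_wickH_vertical_le_wickDom ε hx.1 hx.2

/-- The real part of the boundary function is, a.e., the indicator of `(0,1)` times
`(1−x)^{−1/2}(K(x)³ − 3K(x)K(1−x)²)`. [cite: Zhou2013, Prop. 5.1] -/
theorem wickH₀_re_ae :
    ∀ᵐ x : ℝ, (wickH₀ x).re = Set.indicator (Ioo (0 : ℝ) 1)
      (fun x => (1 - x) ^ (-(1 / 2 : ℝ)) * (ellipticK x ^ 3 - 3 * ellipticK x * ellipticK (1 - x) ^ 2)) x := by
  filter_upwards [ae_ne_zero_and_ne_one] with x hx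
  rcases lt_trichotomy x 0 with h | h | h
  · rw [wickH₀_re_of_neg h, Set.indicator_of_notMem (fun h' => by linarith [h'.1])]
  · exact absurd h hx.1
  · rcases lt_trichotomy x 1 with h1 | h1 | h1
    · rw [wickH₀_re_of_mem_Ioo ⟨h, h1⟩, Set.indicator_of_mem (show x ∈ Ioo (0 : ℝ) 1 from ⟨h, h1⟩)]
    · exact absurd h1 hx.2
    · rw [wickH₀_re_of_one_lt h1, Set.indicator_of_notMem (fun h' => by linarith [h'.2])]

/-- **The Wick rotation identity in parameter form**:
`∫₀¹ (1−x)^{−1/2} (K(x)³ − 3K(x)K(1−x)²) dx = 0`. [cite: Zhou2013, Prop. 5.1 (first ↔ fourth member: ∫K′³ = 3∫K²K′)] -/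
theorem integral_rpow_mul_ellipticK_cube_sub_eq_zero :
    ∫ x in Ioo (0 : ℝ) 1, (1 - x) ^ (-(1 / 2 : ℝ)) * (ellipticK x ^ 3 - 3 * ellipticK x * ellipticK (1 - x) ^ 2) = 0 := by
  have h1 : ∫ x : ℝ, (wickH₀ x).re = 0 := by
    have h := integral_re (𝕜 := ℂ) integrable_wickH₀
    simp only [RCLike.re_to_complex] at h
    rw [h, integral_wickH₀_eq_zero, Complex.zero_re]
  rw [integral_congr_ae wickH₀_re_ae, integral_indicator measurableSet_Ioo] at h1
  exact h1

end ComplexParameter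

/-! ### Back to the modulus: `∫₀¹K′³ = 3∫₀¹K²K′` and the reduction of Prop. 5.1 to (T_half_half) -/

/-- Change of variables `x = 1 − k²` (a decreasing diffeomorphism of `(0,1)`; `|dx/dk| = 2k`):
`∫_{(0,1)} g(x) dx = ∫_{(0,1)} 2k·g(1−k²) dk`, for every `g`. [folklore] -/
theorem integral_Ioo_comp_one_sub_sq (g : ℝ → ℝ) :
    ∫ x in Ioo (0 : ℝ) 1, g x = ∫ k in Ioo (0 : ℝ) 1, 2 * k * g (1 - k ^ 2) := by
  set φ : ℝ → ℝ := fun k => 1 - k ^ 2 with hφ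
  have himage : φ '' Ioo (0 : ℝ) 1 = Ioo 0 1 := by
    ext x
    constructor
    · rintro ⟨k, hk, rfl⟩
      exact ⟨by simp only [hφ]; nlinarith [hk.1, hk.2], by simp only [hφ]; nlinarith [hk.1, hk.2]⟩
    · intro hx
      refine ⟨Real.sqrt (1 - x), ⟨Real.sqrt_pos.mpr (by linarith [hx.2]),
        (Real.sqrt_lt' one_pos).mpr (by linarith [hx.1])⟩, ?_⟩
      simp only [hφ]
      rw [Real.sq_sqrt (by linarith [hx.2])]
      ring
  have hderiv : ∀ k ∈ Ioo (0 : ℝ) 1, HasDerivWithinAt φ (-(2 * k)) (Ioo 0 1) k := by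
    intro k _
    have h1 : HasDerivAt (fun k : ℝ => 1 - k ^ 2) (-(2 * k)) k := by
      simpa using (hasDerivAt_pow 2 k).const_sub 1
    exact h1.hasDerivWithinAt
  have hinj : InjOn φ (Ioo 0 1) := by
    intro a ha b hb hab
    simp only [hφ] at hab
    have h3 : a ^ 2 = b ^ 2 := by linarith
    exact (pow_left_inj₀ ha.1.le hb.1.le two_ne_zero).mp h3
  have key := integral_image_eq_integral_abs_deriv_smul measurableSet_Ioo hderiv hinj g
  rw [himage] at key
  rw [key]
  refine setIntegral_congr_fun measurableSet_Ioo (fun k hk => ?_)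
  simp only [smul_eq_mul, hφ]
  rw [abs_neg, abs_of_pos (by linarith [hk.1])]

/-- **Zhou 2013, Prop. 5.1, layer (a): `∫₀¹ K(√(1−k²))³ dk = 3∫₀¹ K(k)²K(√(1−k²)) dk`** — in
print by Tricomi pairing ("This instantly rearranges into
∫₀¹[K(√(1−k²))]³dk = 3∫₀¹[K(k)]²K(√(1−k²))dk (an identity that Wan conjectured numerically…)"),
here by the Wick rotation `integral_rpow_mul_ellipticK_cube_sub_eq_zero` and `x = 1 − k²`.
[cite: Zhou2013, Prop. 5.1 and its proof (arXiv p. 23)] -/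
theorem integral_completeEllipticK_compl_pow_three_eq_three_mul :
    ∫ k in Ioo (0 : ℝ) 1, completeEllipticK (Real.sqrt (1 - k ^ 2)) ^ 3 =
      3 * ∫ k in Ioo (0 : ℝ) 1, completeEllipticK k ^ 2 * completeEllipticK (Real.sqrt (1 - k ^ 2)) := by
  have h := integral_rpow_mul_ellipticK_cube_sub_eq_zero
  rw [integral_Ioo_comp_one_sub_sq] at h
  -- identify the pulled-back integrand with `2(K′³ − 3K′K²)`
  have hpt : ∀ k ∈ Ioo (0 : ℝ) 1,
      2 * k * ((1 - (1 - k ^ 2)) ^ (-(1 / 2 : ℝ)) *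
        (ellipticK (1 - k ^ 2) ^ 3 - 3 * ellipticK (1 - k ^ 2) * ellipticK (1 - (1 - k ^ 2)) ^ 2)) =
      2 * completeEllipticK (Real.sqrt (1 - k ^ 2)) ^ 3 -
        6 * (completeEllipticK k ^ 2 * completeEllipticK (Real.sqrt (1 - k ^ 2))) := by
    intro k hk
    have hk2 : k ^ 2 ≤ 1 := by nlinarith [hk.1, hk.2]
    have hpow : (k ^ 2) ^ (-(1 / 2 : ℝ)) = k⁻¹ := by
      rw [Real.rpow_neg (sq_nonneg k), ← Real.sqrt_eq_rpow, Real.sqrt_sq hk.1.le]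
    rw [sub_sub_cancel, hpow, completeEllipticK_compl_eq_ellipticK hk2, completeEllipticK_eq_ellipticK]
    have hk0 : k ≠ 0 := hk.1.ne'
    field_simp
    ring
  rw [setIntegral_congr_fun measurableSet_Ioo hpt,
    integral_sub (integrableOn_completeEllipticK_compl_pow_three.const_mul 2)
      (integrableOn_completeEllipticK_sq_mul_compl.const_mul 6),
    integral_const_mul, integral_const_mul] at h
  linarith

/-- **Zhou 2013, Prop. 5.1, first line ↔ last member: `∫₀¹ K(√(1−k²))³ dk = 6∫₀¹ K(k)²K(√(1−k²)) k dk`**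
(layers (a) and (b) combined). [cite: Zhou2013, Prop. 5.1] -/
theorem integral_completeEllipticK_compl_pow_three_eq_six_mul :
    ∫ k in Ioo (0 : ℝ) 1, completeEllipticK (Real.sqrt (1 - k ^ 2)) ^ 3 =
      6 * ∫ k in Ioo (0 : ℝ) 1, completeEllipticK k ^ 2 * completeEllipticK (Real.sqrt (1 - k ^ 2)) * k := by
  rw [integral_completeEllipticK_compl_pow_three_eq_three_mul, integral_K_sq_mul_compl_eq_two_mul]
  ring

/-- **Reduction of Prop. 5.1 to Zhou's eq. (T_half_half)** (Cor. 3.2, the Clebsch–Gordan value,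
"As we recall from Eq. (T_half_half) that `6∫₀¹[K(k)]²K(√(1−k²))k dk = [Γ(¼)]⁸/(128π²)`, the
verification is complete"): given that value, `Zhou2013_prop_5_1` follows from layers (a)+(b) proved
here. The value itself (Prop. 3.1 at `ν = −1/2`, complex-degree Legendre asymptotics) is NOT proved in
the tree. [cite: Zhou2013, Prop. 5.1 (last step of the proof) and Cor. 3.2 eq. (T_half_half)] -/
theorem Zhou2013_prop_5_1_of_T_half_half
    (h : 6 * ∫ k in Ioo (0 : ℝ) 1, completeEllipticK k ^ 2 * completeEllipticK (Real.sqrt (1 - k ^ 2)) * k =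
      Real.Gamma (1 / 4) ^ 8 / (128 * Real.pi ^ 2)) :
    Zhou2013_prop_5_1 := by
  unfold Zhou2013_prop_5_1
  rw [integral_completeEllipticK_compl_pow_three_eq_six_mul, h]

end Literature.Analysis.SpecialFunctions

end
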